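import Literature.NumberTheory.Sieve.LinearEquationsInPrimesEnvelopingSieveLinearForms
import Literature.NumberTheory.Sieve.LinearEquationsInPrimesEnvelopingSieveTau
import Literature.NumberTheory.Sieve.LinearEquationsInPrimesDivisorMoments
import HarnessLib

/-!
# The enveloping sieve: the correlation condition for Green–Tao's measure (Green–Tao 2010, App. D)

Trunk T-SIEVE (`Literature/NumberTheory/Sieve`). Part of the App. D layer of the decomposition of
`Literature.NumberTheory.Sieve.GreenTaoZiegler2012_finiteComplexity`. B. Green, T. Tao, *Linear
equations in primes*, Ann. of Math. 171 (2010), App. D, proof of Prop. 6.4 (p. 48 of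
arXiv:math/0606088) verifies the `D`-correlation condition (Def. 6.3) for the enveloping-sieve
measure `ν = ½ + ½ ν̃` of `LinearEquationsInPrimesEnvelopingSieveMeasure.lean`:

> "Now we verify the `D`-correlation condition for `ν`. As before we can pass from `ν` to `ν̃`,
> and reduce to showing that `∑_{n ∈ I} ∏_{j ∈ [m]} ν̃(n + h_j) ≪ N ∑_{1 ≤ j < j' ≤ m} τ(h_j - h_{j'})`
> … We may assume that no two of the `h_i` are equal as in this case one can use crude divisor
> estimates, setting `τ(0)` to be moderately large … Again, we split up `ν̃` and reduce to showing
> [the correlation display] … It follows from this analysis that if we set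
> `τ(n) := ∑_{1 ≤ j < j' ≤ m} exp(O(∑_{p > w, p | Wn + b_{i_j} - b_{i_{j'}}} p^{-1/2}))` then we obtain
> the desired correlation estimate. To show the moment bounds on `τ` it suffices to show that
> `𝔼_{n ∈ [N]} exp(q ∑_{p > w, p | Wn + h} p^{-1/2}) ≪_q 1` for all `h = O(W)`."

This file PROVES that verification relative to the two Goldston–Yıldırım displays vendored in
`LinearEquationsInPrimesEnvelopingSieveFacts.lean`:
`Literature.NumberTheory.Sieve.GreenTao2010_envelopingSieve_correlationCondition_of_linearForms_of_correlations :
  GreenTao2010_envelopingSieve_linearForms → GreenTao2010_envelopingSieve_correlations →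
  GreenTao2010_envelopingSieve_correlationCondition`.

## The argument as formalised

* Passing from `ν` to `ν̃` (`prod_gtMeasure_le_sum_powerset`): on `ℤ_{N'}`, `ν = g₁ + g₀` with
  `g₁ = ½ 1_{[N]} ν̃ ≥ 0` and `0 ≤ g₀ = 1 - ½ 1_{[N]} ≤ 1`, so
  `∏ᵢ ν(n + hᵢ) ≤ ∑_{S ⊆ [m]} ∏_{i ∈ S} g₁(n + hᵢ)`; the subsets with `|S| ≤ 1` are bounded using
  `𝔼 ν̃ = O(1)`, which is the one-form case `d = m = 1`, `K = [1,N]` of the linear forms display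
  (D.8) (`MeanEstimateAt`, `meanEstimateAt_of_linearForms`, `sum_gtPreMeasure_le`).
* Unwrapping (`gtWeightPart_add_natCast`, `sum_prod_gtWeightPart_le`): a residue `n + hᵢ` with
  `n, h̃ᵢ ∈ [0, N')` lies in `[N]` iff exactly one of its lifts `n + h̃ᵢ - k N'`, `k ∈ {0,1}`, does
  (`N < N'`); expanding over the `2^s` lift patterns, the good `n` form a window of length `≤ N`
  which is shifted so that the shifts lie in `[1, N]`, the products of `ν̃` are split over residue
  assignments `r : [s] → [t]` ("we split up `ν̃`"), and the correlation display is applied on the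
  window (`CorrEstimateAt`, `sum_prod_gtWeightInt_le`). The difference of two unwrapped shifts is
  `(hᵢ - hᵢ')~ + ℓ N'` with `ℓ ∈ {-2,-1,0,1}` (`exists_lift_of_sub`), so every exponential the
  display produces is a term of the pair weight `e(hᵢ - hᵢ')` of `…EnvelopingSieveTau.lean`.
* The coincident case (`sum_gtMeasure_pow_div_le`): by AM–GM and translation invariance
  `𝔼 ∏ᵢ ν(n + hᵢ) ≤ 𝔼 ν^m ≤ T₀ = 1 + c^{-m} B^{2m} (1 + log N)^{m + f(2m,0)}` from the crude divisor
  moments of `LinearEquationsInPrimesDivisorMoments.lean` (`|χ| ≤ B`).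
* The weight `τ(x) = 2^D + 1_{x=0} T₀ + T₁ e(x)` (`gtTau`) and the estimate
  `𝔼 ∏ᵢ ν(n + hᵢ) ≤ ∑_{i<j} τ(hᵢ - hⱼ)` (`gtMeasure_correlation`); its moments
  `𝔼 τ^q ≤ A(m,q)` uniformly in `N, w, b, N'` (`sum_gtTau_rpow_div_le`, with the explicit
  `gtMomentConst`), the pair-weight moments being those of `…EnvelopingSieveTau.lean` (valid for
  every real `q ≥ 1` with the cutoff `w` fixed before `q`, by raising the cutoff).

## Rendering notes

* Def. 6.3 is used in the quantitative form of `…Pseudorandom.lean` (`CorrelationCondition D A ν`: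
  moments `𝔼 τ^q ≤ A m q` for all real `q ≥ 1`).
* The printed `τ` sums the exponential over all pairs of residues; ours is the pair-matched,
  lift-summed weight of `…EnvelopingSieveTau.lean` plus the constant and the coincident term, which
  is what the printed analysis needs ("setting `τ(0)` to be moderately large").
* `γ ≤ γ₀(C,D,t,χ)` is the least of the exponents of the displays for `2 ≤ s ≤ D` forms, of the
  one-form estimate, and of `1/(2D)` (so that `R^{2m} ≤ N` in the crude bound).

## References

* B. Green, T. Tao, *Linear equations in primes*, Ann. of Math. (2) 171 (2010), 1753–1850
  (arXiv:math/0606088): Def. 6.3, Prop. 6.4, App. D (proof of Prop. 6.4, verification of the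
  correlation condition; display (D.8)).
* B. Green, T. Tao, *The primes contain arbitrarily long arithmetic progressions*, Ann. of
  Math. (2) 167 (2008), Prop. 9.6, Lemma 9.10 and Prop. 9.8 (the ancestors of the argument).
-/

noncomputable section

open Finset

namespace Literature.NumberTheory.Sieve

variable {t : ℕ}

/-! ### Decomposition `ν = g₁ + g₀` on `ℤ_{N'}` -/

section Decomposition

variable (χ : ℝ → ℝ) (γ : ℝ) (N w : ℕ) (b : Fin t → ℕ) (N' : ℕ)

/-- The weight part `g₁ = ½ 1_{[N]} ν̃` of Green–Tao's measure `ν = ½ + ½ ν̃` on `[N]`, `1` off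
`[N]` ("As before we can pass from `ν` to `ν̃`"). [cite: GreenTao2010, App. D (proof of
Prop. 6.4, verification of the correlation condition)] -/
def gtWeightPart (x : ZMod N') : ℝ :=
  if 1 ≤ x.val ∧ x.val ≤ N then gtPreMeasure χ γ N w b x.val / 2 else 0

/-- The bounded part `g₀ = 1 - ½ 1_{[N]}` of Green–Tao's measure. [cite: GreenTao2010, App. D
(proof of Prop. 6.4, verification of the correlation condition)] -/
def gtConstPart (x : ZMod N') : ℝ :=
  if 1 ≤ x.val ∧ x.val ≤ N then 1 / 2 else 1

/-- `ν = g₁ + g₀`. [folklore] -/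
theorem gtMeasure_eq_add (x : ZMod N') :
    gtMeasure χ γ N w b N' x = gtWeightPart χ γ N w b N' x + gtConstPart N N' x := by
  unfold gtMeasure gtWeightPart gtConstPart
  split_ifs <;> ring

/-- `0 ≤ g₀`. [folklore] -/
theorem gtConstPart_nonneg (x : ZMod N') : 0 ≤ gtConstPart N N' x := by
  unfold gtConstPart; split_ifs <;> norm_num

/-- `g₀ ≤ 1`. [folklore] -/
theorem gtConstPart_le_one (x : ZMod N') : gtConstPart N N' x ≤ 1 := by
  unfold gtConstPart; split_ifs <;> norm_num

variable {χ γ N w b N'}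

/-- `0 ≤ g₁`. [folklore] -/
theorem gtWeightPart_nonneg (hγ : 0 ≤ γ) (hN : 1 ≤ N) (x : ZMod N') :
    0 ≤ gtWeightPart χ γ N w b N' x := by
  unfold gtWeightPart
  split_ifs
  · exact div_nonneg (gtPreMeasure_nonneg χ hγ hN w b _) (by norm_num)
  · exact le_rfl

/-- **Passing from `ν` to `ν̃`**: expanding `∏ᵢ (g₁ + g₀)(n + hᵢ)` and bounding the `g₀`-factors
by `1`, `∏_{i} ν(n + hᵢ) ≤ ∑_{S ⊆ [m]} ∏_{i ∈ S} g₁(n + hᵢ)`. [cite: GreenTao2010, App. D (proof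
of Prop. 6.4: "As before we can pass from `ν` to `ν̃`")] -/
theorem prod_gtMeasure_le_sum_powerset {m : ℕ} (hγ : 0 ≤ γ) (hN : 1 ≤ N) (h : Fin m → ZMod N')
    (n : ZMod N') :
    ∏ i, gtMeasure χ γ N w b N' (n + h i) ≤
      ∑ S ∈ (Finset.univ : Finset (Fin m)).powerset, ∏ i ∈ S, gtWeightPart χ γ N w b N' (n + h i) := by
  classical
  simp_rw [gtMeasure_eq_add]
  rw [Finset.prod_add]
  refine Finset.sum_le_sum fun S _ => ?_
  have h1 : ∏ i ∈ Finset.univ \ S, gtConstPart N N' (n + h i) ≤ 1 :=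
    Finset.prod_le_one (fun i _ => gtConstPart_nonneg N N' _) fun i _ => gtConstPart_le_one N N' _
  have h0 : 0 ≤ ∏ i ∈ S, gtWeightPart χ γ N w b N' (n + h i) :=
    Finset.prod_nonneg fun i _ => gtWeightPart_nonneg hγ hN _
  calc (∏ i ∈ S, gtWeightPart χ γ N w b N' (n + h i)) * ∏ i ∈ Finset.univ \ S, gtConstPart N N' (n + h i)
      ≤ (∏ i ∈ S, gtWeightPart χ γ N w b N' (n + h i)) * 1 := mul_le_mul_of_nonneg_left h1 h0
    _ = _ := mul_one _

end Decomposition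

/-! ### Unwrapping `ℤ_{N'}` to the integers -/

section Unwrap

variable (χ : ℝ → ℝ) (γ : ℝ) (N w : ℕ) (b : Fin t → ℕ)

/-- The integer model `F(z) = ½ 1_{[1,N]}(z) ν̃(z)` of `g₁`. [folklore] -/
def gtWeightInt (z : ℤ) : ℝ :=
  if 1 ≤ z ∧ z ≤ N then gtPreMeasure χ γ N w b z / 2 else 0

variable {χ γ N w b}

/-- `0 ≤ F`. [folklore] -/
theorem gtWeightInt_nonneg (hγ : 0 ≤ γ) (hN : 1 ≤ N) (z : ℤ) : 0 ≤ gtWeightInt χ γ N w b z := by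
  unfold gtWeightInt
  split_ifs
  · exact div_nonneg (gtPreMeasure_nonneg χ hγ hN w b _) (by norm_num)
  · exact le_rfl

/-- **Unwrapping one shifted factor**: for representatives `v, h̃ ∈ [0, N')` and `N < N'`,
`g₁(v + h̃ mod N') = F(v + h̃) + F(v + h̃ - N')` — exactly one of the two lifts of the residue can
lie in `[1, N] ⊂ [0, N')`. [cite: GreenTao2010, App. D (proof of Prop. 6.4: "where we identify `n`
with an element of `ℤ_{N'}` in the obvious manner")] -/
theorem gtWeightPart_add_natCast {N' : ℕ} [NeZero N'] (hNN' : N < N') {v e : ℕ} (hv : v < N')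
    (he : e < N') :
    gtWeightPart χ γ N w b N' ((v : ZMod N') + (e : ZMod N')) =
      gtWeightInt χ γ N w b ((v : ℤ) + e) + gtWeightInt χ γ N w b ((v : ℤ) + e - N') := by
  rw [← Nat.cast_add]
  unfold gtWeightPart gtWeightInt
  rcases lt_or_ge (v + e) N' with hlt | hge
  · -- no wrap: `val = v + e`, the second lift is negative
    have hval : ((v + e : ℕ) : ZMod N').val = v + e := ZMod.val_natCast_of_lt hlt
    rw [hval]
    have h2 : ¬ (1 ≤ (v : ℤ) + e - N' ∧ (v : ℤ) + e - N' ≤ N) := by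
      intro ⟨h1, _⟩; omega
    rw [if_neg h2, add_zero]
    by_cases h1 : 1 ≤ v + e ∧ v + e ≤ N
    · rw [if_pos h1, if_pos (by omega), Nat.cast_add]
    · rw [if_neg h1, if_neg (by omega)]
  · -- wrap: `val = v + e - N'`, the first lift exceeds `N`
    have hval : ((v + e : ℕ) : ZMod N').val = v + e - N' := by
      rw [ZMod.val_natCast]
      have : v + e = (v + e - N') + N' * 1 := by omega
      conv_lhs => rw [this]
      rw [Nat.add_mul_mod_self_left, Nat.mod_eq_of_lt (by omega)]
    rw [hval]
    have h1 : ¬ (1 ≤ (v : ℤ) + e ∧ (v : ℤ) + e ≤ N) := by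
      intro ⟨_, h2⟩; omega
    rw [if_neg h1, zero_add]
    by_cases h2 : 1 ≤ v + e - N' ∧ v + e - N' ≤ N
    · rw [if_pos h2, if_pos (by omega)]
      rw [Nat.cast_sub hge, Nat.cast_add]
    · rw [if_neg h2, if_neg (by omega)]

/-- The two lifts as a sum over `k ∈ {0, 1}`. [folklore] -/
theorem gtWeightPart_add_natCast' {N' : ℕ} [NeZero N'] (hNN' : N < N') {v e : ℕ} (hv : v < N')
    (he : e < N') :
    gtWeightPart χ γ N w b N' ((v : ZMod N') + (e : ZMod N')) =
      ∑ k ∈ ({0, 1} : Finset ℤ), gtWeightInt χ γ N w b ((v : ℤ) + (e - k * N')) := by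
  rw [gtWeightPart_add_natCast hNN' hv he, Finset.sum_pair (by norm_num)]
  congr 1 <;> (congr 1; ring)

end Unwrap

/-! ### Generic reindexing -/

/-- A sum of non-negative terms along an injection is at most the sum over any set containing the
image. [folklore] -/
theorem sum_comp_le_sum_of_injOn {α β : Type*} [DecidableEq β] {s : Finset α} {T : Finset β}
    {f : α → β} (hf : Set.InjOn f s) (hfT : ∀ a ∈ s, f a ∈ T) {g : β → ℝ} (hg : ∀ x ∈ T, 0 ≤ g x) :
    ∑ a ∈ s, g (f a) ≤ ∑ x ∈ T, g x := by
  rw [← Finset.sum_image (g := f) (f := g) hf]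
  refine Finset.sum_le_sum_of_subset_of_nonneg (fun x hx => ?_) fun x hx _ => hg x hx
  obtain ⟨a, ha, rfl⟩ := Finset.mem_image.mp hx
  exact hfT a ha

/-! ### The instance of the correlation display used for one subset of shifts -/

/-- The conclusion of the correlation display `GreenTao2010_envelopingSieve_correlations` at a fixed
number `s` of forms, cutoff `χ`, exponent `γ`, constant `C`, scale `N` and cutoff `w` (the tail of
that fact after its thresholds). [cite: GreenTao2010, App. D (proof of Prop. 6.4, the correlation
display)] -/
def CorrEstimateAt (χ : ℝ → ℝ) (γ : ℝ) (N w s : ℕ) (C : ℝ) : Prop :=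
  ∀ b : Fin s → ℕ, (∀ j, 1 ≤ b j ∧ b j ≤ primorial w ∧ Nat.Coprime (b j) (primorial w)) →
    ∀ h : Fin s → ℤ, (∀ j, |h j| ≤ N) → (∀ j j', j ≠ j' → (h j, b j) ≠ (h j', b j')) →
    ∀ lo hi : ℤ, -(N : ℤ) ≤ lo → hi ≤ N →
      ((Nat.totient (primorial w) : ℝ) / primorial w) ^ s *
          ∑ n ∈ Finset.Icc lo hi,
            ∏ j, truncDivisorSum χ ((N : ℝ) ^ γ) 2 ((primorial w : ℤ) * (n + h j) + b j) ≤
        C * N * ∑ j : Fin s, ∑ j' : Fin s,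
          if j < j' then
            Real.exp (C * ∑ p ∈ roughPrimeFactors w
              (Int.natAbs ((primorial w : ℤ) * (h j - h j') + b j - b j')), (p : ℝ) ^ (-(1 / 2 : ℝ)))
          else 0

/-- The correlation display supplies `CorrEstimateAt` past its thresholds. [cite: GreenTao2010,
App. D (proof of Prop. 6.4, the correlation display)] -/
theorem corrEstimateAt_of_correlations (hF : GreenTao2010_envelopingSieve_correlations) {s : ℕ} (hs : 2 ≤ s)
    {χ : ℝ → ℝ} (hχ : IsSmoothCompactCutoff χ) :
    ∃ γ₀ : ℝ, 0 < γ₀ ∧ ∀ γ : ℝ, 0 < γ → γ ≤ γ₀ → ∃ C : ℝ, 0 < C ∧ ∃ w₀ N₀ : ℕ,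
      ∀ N : ℕ, N₀ ≤ N → ∀ w : ℕ, w₀ ≤ w → (w : ℝ) ≤ Real.log (Real.log N) / 2 →
        CorrEstimateAt χ γ N w s C := by
  obtain ⟨γ₀, hγ₀, H⟩ := hF s χ hs hχ
  refine ⟨γ₀, hγ₀, fun γ hγ hγle => ?_⟩
  obtain ⟨C, hC, w₀, N₀, H'⟩ := H γ hγ hγle
  exact ⟨C, hC, w₀, N₀, fun N hN w hw hwN b hb h hh hdis lo hi hlo hhi =>
    H' N hN w hw hwN b hb h hh hdis lo hi hlo hhi⟩

/-! ### Lifts of a difference of two unwrapped shifts -/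

/-- **The lift of a difference**: if two residues `x, y ∈ ℤ_{N'}` are unwrapped to
`x̃ - k_x N'`, `ỹ - k_y N'` with `k_x, k_y ∈ {0,1}`, then the difference of the unwrapped values is
`(x - y)~ + ℓ N'` for some `ℓ ∈ {-2, -1, 0, 1}`. [folklore] -/
theorem exists_lift_of_sub {N' : ℕ} [NeZero N'] (x y : ZMod N') {kx ky : ℤ}
    (hkx : kx = 0 ∨ kx = 1) (hky : ky = 0 ∨ ky = 1) :
    ∃ ℓ ∈ corrLiftSet, ((x.val : ℤ) - kx * N') - ((y.val : ℤ) - ky * N') = ((x - y).val : ℤ) + ℓ * N' := by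
  have hN'0 : (0 : ℤ) < N' := by exact_mod_cast Nat.pos_of_ne_zero (NeZero.ne N')
  have hval : (((x - y).val : ℕ) : ℤ) = ((x.val : ℤ) - y.val) % (N' : ℤ) := by
    have hxy : x - y = ((((x.val : ℤ) - y.val) : ℤ) : ZMod N') := by
      rw [Int.cast_sub, Int.cast_natCast, Int.cast_natCast, ZMod.natCast_zmod_val,
        ZMod.natCast_zmod_val]
    rw [hxy, ZMod.val_intCast]
  have hx := ZMod.val_lt x
  have hy := ZMod.val_lt y
  have ha1 : -(N' : ℤ) < (x.val : ℤ) - y.val := by omega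
  have ha2 : (x.val : ℤ) - y.val < N' := by omega
  have hq1 : -1 ≤ ((x.val : ℤ) - y.val) / N' := (Int.le_ediv_iff_mul_le hN'0).mpr (by linarith)
  have hq2 : ((x.val : ℤ) - y.val) / N' < 1 := (Int.ediv_lt_iff_lt_mul hN'0).mpr (by linarith)
  have hdecomp : ((x.val : ℤ) - y.val) % N' + N' * (((x.val : ℤ) - y.val) / N') = (x.val : ℤ) - y.val :=
    Int.emod_add_mul_ediv _ _
  refine ⟨((x.val : ℤ) - y.val) / N' - kx + ky, mem_corrLiftSet.mpr (by omega), ?_⟩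
  rw [hval]
  linear_combination (-1 : ℤ) * hdecomp

/-! ### One subset of shifts, one choice of lifts: the correlation display -/

variable {χ : ℝ → ℝ} {γ : ℝ} {N w : ℕ} {b : Fin t → ℕ}

/-- On the good set all factors `F(v + h'_j)` are `½ ν̃(v + h'_j)`; elsewhere the product vanishes.
[folklore] -/
theorem prod_gtWeightInt_eq {s : ℕ} (h' : Fin s → ℤ) (v : ℕ) :
    ∏ j, gtWeightInt χ γ N w b ((v : ℤ) + h' j) =
      if ∀ j, 1 ≤ (v : ℤ) + h' j ∧ (v : ℤ) + h' j ≤ N then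
        (1 / 2) ^ s * ∏ j, gtPreMeasure χ γ N w b ((v : ℤ) + h' j) else 0 := by
  split_ifs with hall
  · unfold gtWeightInt
    rw [Finset.prod_congr rfl fun j _ => if_pos (hall j), Finset.prod_div_distrib,
      Finset.prod_const, Finset.card_univ, Fintype.card_fin, div_eq_mul_one_div, mul_comm, one_div_pow]
  · push Not at hall
    obtain ⟨j, hj⟩ := hall
    refine Finset.prod_eq_zero (Finset.mem_univ j) ?_
    unfold gtWeightInt
    rw [if_neg]
    intro ⟨h1, h2⟩
    exact absurd (hj h1) (not_lt.mpr h2)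

/-- **One subset, one lift**: for an injective family of integer shifts `h'` and a scale `N` at
which the correlation display holds with constant `C`,
`∑_{v} ∏_j F(v + h'_j) ≤ 2^{-s} (tc)^{-s} ∑_{r : [s] → [t]} C N ∑_{j<j'} exp(C S_w(|W(h'_j - h'_{j'}) + b_{r_j} - b_{r_{j'}}|))`
(restrict to the good `v`, shift to the least good `v₀` so that the shifts `v₀ + h'_j` lie in
`[1, N]`, expand `ν̃`, apply the display on the window `[0, N-1]`).
[cite: GreenTao2010, App. D (proof of Prop. 6.4: "We can apply Theorem D.3 with the system of
forms `Ψ = (W(n + h_j) + b_{i_j})_{j=1}^m`")] -/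
theorem sum_prod_gtWeightInt_le {s : ℕ} (hs : 1 ≤ s) (hγ : 0 ≤ γ) (hN : 1 ≤ N)
    (hb : ∀ i, 1 ≤ b i ∧ b i ≤ primorial w ∧ Nat.Coprime (b i) (primorial w))
    {C : ℝ} (hC : 0 ≤ C) (hF : CorrEstimateAt χ γ N w s C)
    (h' : Fin s → ℤ) (hinj : Function.Injective h') (S : Finset ℕ) :
    ∑ v ∈ S, ∏ j, gtWeightInt χ γ N w b ((v : ℤ) + h' j) ≤
      (1 / 2) ^ s * (1 / ((t : ℝ) * GreenTao2008.cChi χ)) ^ s *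
        ∑ r ∈ Fintype.piFinset (fun _ : Fin s => (Finset.univ : Finset (Fin t))),
          C * N * ∑ j : Fin s, ∑ j' : Fin s, if j < j' then
            Real.exp (C * roughSum w (Int.natAbs ((primorial w : ℤ) * (h' j - h' j') + b (r j) - b (r j'))))
            else 0 := by
  classical
  have htc0 : 0 ≤ 1 / ((t : ℝ) * GreenTao2008.cChi χ) :=
    div_nonneg zero_le_one (mul_nonneg (Nat.cast_nonneg _) (GreenTao2008.cChi_nonneg χ))
  have hN0 : (0 : ℝ) ≤ N := Nat.cast_nonneg N
  -- the right-hand side is non-negative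
  have hRHS : 0 ≤ ∑ r ∈ Fintype.piFinset (fun _ : Fin s => (Finset.univ : Finset (Fin t))),
      C * N * ∑ j : Fin s, ∑ j' : Fin s, if j < j' then
        Real.exp (C * roughSum w (Int.natAbs ((primorial w : ℤ) * (h' j - h' j') + b (r j) - b (r j')))) else 0 :=
    Finset.sum_nonneg fun r _ => mul_nonneg (mul_nonneg hC hN0)
      (Finset.sum_nonneg fun j _ => Finset.sum_nonneg fun j' _ => by
        split_ifs
        · exact (Real.exp_pos _).le
        · exact le_rfl)
  -- Step 1: restrict to the good set
  set I := S.filter (fun v : ℕ => ∀ j, 1 ≤ (v : ℤ) + h' j ∧ (v : ℤ) + h' j ≤ N) with hI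
  have hzero : ∀ v ∈ S, v ∉ I → ∏ j, gtWeightInt χ γ N w b ((v : ℤ) + h' j) = 0 := by
    intro v hvS hvI
    rw [prod_gtWeightInt_eq, if_neg]
    intro hall
    exact hvI (Finset.mem_filter.mpr ⟨hvS, hall⟩)
  have hstep1 : ∑ v ∈ S, ∏ j, gtWeightInt χ γ N w b ((v : ℤ) + h' j) =
      (1 / 2) ^ s * ∑ v ∈ I, ∏ j, gtPreMeasure χ γ N w b ((v : ℤ) + h' j) := by
    rw [← Finset.sum_subset (Finset.filter_subset _ S) hzero, Finset.mul_sum]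
    refine Finset.sum_congr rfl fun v hv => ?_
    rw [prod_gtWeightInt_eq, if_pos (Finset.mem_filter.mp hv).2]
  rw [hstep1, mul_assoc]
  refine mul_le_mul_of_nonneg_left ?_ (by positivity)
  rcases I.eq_empty_or_nonempty with hIe | hIne
  · rw [hIe, Finset.sum_empty]
    exact mul_nonneg (pow_nonneg htc0 s) hRHS
  -- Step 2: shift to the least good point
  set v₀ : ℕ := I.min' hIne with hv₀
  have hv₀I : v₀ ∈ I := Finset.min'_mem I hIne
  have hv₀good : ∀ j, 1 ≤ (v₀ : ℤ) + h' j ∧ (v₀ : ℤ) + h' j ≤ N := (Finset.mem_filter.mp hv₀I).2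
  have hwindow : ∀ v ∈ I, v₀ ≤ v ∧ v ≤ v₀ + (N - 1) := by
    intro v hv
    refine ⟨Finset.min'_le I v hv, ?_⟩
    have h1 := ((Finset.mem_filter.mp hv).2 ⟨0, hs⟩).2
    have h2 := (hv₀good ⟨0, hs⟩).1
    omega
  have hpre0 : ∀ y : ℤ, 0 ≤ gtPreMeasure χ γ N w b y := fun y => gtPreMeasure_nonneg χ hγ hN w b y
  have hstep2 : ∑ v ∈ I, ∏ j, gtPreMeasure χ γ N w b ((v : ℤ) + h' j) ≤
      ∑ n ∈ Finset.Icc (0 : ℤ) ((N : ℤ) - 1), ∏ j, gtPreMeasure χ γ N w b (n + ((v₀ : ℤ) + h' j)) := by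
    have key := sum_comp_le_sum_of_injOn (s := I) (T := Finset.Icc (0 : ℤ) ((N : ℤ) - 1))
      (f := fun v : ℕ => (v : ℤ) - v₀) (g := fun n => ∏ j, gtPreMeasure χ γ N w b (n + ((v₀ : ℤ) + h' j)))
      (fun v _ v' _ h => by
        simp only at h
        have : (v : ℤ) = v' := by linarith
        exact_mod_cast this)
      (fun v hv => by
        obtain ⟨h1, h2⟩ := hwindow v hv
        simp only [Finset.mem_Icc]
        omega)
      (fun n _ => Finset.prod_nonneg fun j _ => hpre0 _)
    refine le_trans (le_of_eq ?_) key
    refine Finset.sum_congr rfl fun v _ => Finset.prod_congr rfl fun j _ => ?_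
    congr 1
    ring
  refine hstep2.trans ?_
  -- Step 3: expand the products of `ν̃` over residue assignments and apply the display
  simp_rw [prod_gtPreMeasure_eq]
  rw [← Finset.mul_sum, Finset.sum_comm]
  -- the display, for each residue assignment
  have hdisp : ∀ r ∈ Fintype.piFinset (fun _ : Fin s => (Finset.univ : Finset (Fin t))),
      ((Nat.totient (primorial w) : ℝ) / primorial w) ^ s * ∑ n ∈ Finset.Icc (0 : ℤ) ((N : ℤ) - 1),
        ∏ j, truncDivisorSum χ ((N : ℝ) ^ γ) 2 ((primorial w : ℤ) * (n + ((v₀ : ℤ) + h' j)) + b (r j)) ≤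
      C * N * ∑ j : Fin s, ∑ j' : Fin s, if j < j' then
        Real.exp (C * roughSum w (Int.natAbs ((primorial w : ℤ) * (h' j - h' j') + b (r j) - b (r j')))) else 0 := by
    intro r _
    have h1 := hF (fun j => b (r j)) (fun j => hb (r j)) (fun j => (v₀ : ℤ) + h' j)
      (fun j => abs_le.mpr ⟨by linarith [(hv₀good j).1], (hv₀good j).2⟩)
      (fun j j' hjj' heq => hjj' (hinj (by
        have h1 : (v₀ : ℤ) + h' j = (v₀ : ℤ) + h' j' := congrArg Prod.fst heq
        linarith)))
      0 ((N : ℤ) - 1) (by simp) (by linarith)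
    refine h1.trans (le_of_eq ?_)
    congr 1
    refine Finset.sum_congr rfl fun j _ => Finset.sum_congr rfl fun j' _ => ?_
    split_ifs
    · have hx : (primorial w : ℤ) * ((v₀ : ℤ) + h' j - ((v₀ : ℤ) + h' j')) + b (r j) - b (r j') =
          (primorial w : ℤ) * (h' j - h' j') + b (r j) - b (r j') := by ring
      rw [hx]
      rfl
    · rfl
  calc ((Nat.totient (primorial w) : ℝ) / primorial w / (t * GreenTao2008.cChi χ)) ^ s *
        ∑ r ∈ Fintype.piFinset (fun _ : Fin s => (Finset.univ : Finset (Fin t))),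
          ∑ n ∈ Finset.Icc (0 : ℤ) ((N : ℤ) - 1),
            ∏ j, truncDivisorSum χ ((N : ℝ) ^ γ) 2 ((primorial w : ℤ) * (n + ((v₀ : ℤ) + h' j)) + b (r j))
      = (1 / (t * GreenTao2008.cChi χ)) ^ s *
          ∑ r ∈ Fintype.piFinset (fun _ : Fin s => (Finset.univ : Finset (Fin t))),
            ((Nat.totient (primorial w) : ℝ) / primorial w) ^ s * ∑ n ∈ Finset.Icc (0 : ℤ) ((N : ℤ) - 1),
              ∏ j, truncDivisorSum χ ((N : ℝ) ^ γ) 2 ((primorial w : ℤ) * (n + ((v₀ : ℤ) + h' j)) + b (r j)) := by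
        rw [Finset.mul_sum, Finset.mul_sum]
        refine Finset.sum_congr rfl fun r _ => ?_
        rw [div_eq_mul_one_div _ ((t : ℝ) * GreenTao2008.cChi χ), mul_pow]
        ring
    _ ≤ (1 / (t * GreenTao2008.cChi χ)) ^ s *
          ∑ r ∈ Fintype.piFinset (fun _ : Fin s => (Finset.univ : Finset (Fin t))),
            C * N * ∑ j : Fin s, ∑ j' : Fin s, if j < j' then
              Real.exp (C * roughSum w (Int.natAbs ((primorial w : ℤ) * (h' j - h' j') + b (r j) - b (r j'))))
              else 0 :=
        mul_le_mul_of_nonneg_left (Finset.sum_le_sum hdisp) (pow_nonneg htc0 s)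

/-! ### One subset of shifts: all lifts, and the pair weight -/

/-- **One subset of shifts** (`|S| = s ≥ 1` distinct shifts `e_j ∈ ℤ_{N'}`): unwrapping each
factor into its two lifts, applying `sum_prod_gtWeightInt_le` to each of the `2^s` lift patterns,
and dominating every exponential by the pair weight at the residue difference `e_j - e_{j'}`
(`exists_lift_of_sub`),
`∑_{n ∈ ℤ_{N'}} ∏_j g₁(n + e_j) ≤ c^{-s} C N ∑_{j<j'} e(e_j - e_{j'})` for any `Cₑ ≥ C` in the
pair weight. [cite: GreenTao2010, App. D (proof of Prop. 6.4, verification of the correlation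
condition)] -/
theorem sum_prod_gtWeightPart_le {s : ℕ} (hs : 1 ≤ s) (hγ : 0 ≤ γ) (hN : 1 ≤ N) (ht : 1 ≤ t)
    (hc : 0 < GreenTao2008.cChi χ)
    (hb : ∀ i, 1 ≤ b i ∧ b i ≤ primorial w ∧ Nat.Coprime (b i) (primorial w))
    {N' : ℕ} [NeZero N'] (hNN' : N < N') {C : ℝ} (hC : 0 ≤ C) (hF : CorrEstimateAt χ γ N w s C)
    {Cₑ : ℝ} (hCC : C ≤ Cₑ) (e : Fin s → ZMod N') (he : Function.Injective e) :
    ∑ n : ZMod N', ∏ j, gtWeightPart χ γ N w b N' (n + e j) ≤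
      (1 / GreenTao2008.cChi χ) ^ s * C * N *
        ∑ j : Fin s, ∑ j' : Fin s, if j < j' then corrPairWeight Cₑ w b N' (e j - e j') else 0 := by
  classical
  set PW : ℝ := ∑ j : Fin s, ∑ j' : Fin s, if j < j' then corrPairWeight Cₑ w b N' (e j - e j') else 0
    with hPW
  have hPW0 : 0 ≤ PW := Finset.sum_nonneg fun j _ => Finset.sum_nonneg fun j' _ => by
    split_ifs
    · exact corrPairWeight_nonneg _ _ _ _ _
    · exact le_rfl
  have ht0 : (0 : ℝ) < t := by exact_mod_cast ht
  have hN0 : (0 : ℝ) ≤ N := Nat.cast_nonneg N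
  have htc0 : 0 ≤ 1 / ((t : ℝ) * GreenTao2008.cChi χ) := by positivity
  -- Step 1: unwrap every factor into its two lifts and expand the product
  rw [Literature.NumberTheory.LFunctions.sum_zmod_eq_sum_range]
  have hunw : ∀ v ∈ range N', ∏ j, gtWeightPart χ γ N w b N' ((v : ZMod N') + e j) =
      ∑ k ∈ Fintype.piFinset (fun _ : Fin s => ({0, 1} : Finset ℤ)),
        ∏ j, gtWeightInt χ γ N w b ((v : ℤ) + (((e j).val : ℤ) - k j * N')) := by
    intro v hv
    have hv' := Finset.mem_range.mp hv
    have hj : ∀ j, gtWeightPart χ γ N w b N' ((v : ZMod N') + e j) =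
        ∑ k ∈ ({0, 1} : Finset ℤ), gtWeightInt χ γ N w b ((v : ℤ) + (((e j).val : ℤ) - k * N')) := by
      intro j
      conv_lhs => rw [← ZMod.natCast_zmod_val (e j)]
      exact gtWeightPart_add_natCast' hNN' hv' (ZMod.val_lt (e j))
    rw [Finset.prod_congr rfl fun j _ => hj j, Finset.prod_univ_sum]
  rw [Finset.sum_congr rfl hunw, Finset.sum_comm]
  -- Step 2: each lift pattern
  have hk : ∀ k ∈ Fintype.piFinset (fun _ : Fin s => ({0, 1} : Finset ℤ)),
      ∑ v ∈ range N', ∏ j, gtWeightInt χ γ N w b ((v : ℤ) + (((e j).val : ℤ) - k j * N')) ≤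
        (1 / 2) ^ s * (1 / ((t : ℝ) * GreenTao2008.cChi χ)) ^ s * ((t : ℝ) ^ s * (C * N * PW)) := by
    intro k hk
    have hk01 : ∀ j, k j = 0 ∨ k j = 1 := fun j => by
      simpa using Fintype.mem_piFinset.mp hk j
    -- the unwrapped shifts are distinct
    have hinj : Function.Injective (fun j => ((e j).val : ℤ) - k j * N') := by
      intro j j' hjj'
      simp only at hjj'
      have hvj := ZMod.val_lt (e j)
      have hvj' := ZMod.val_lt (e j')
      have hval : (e j).val = (e j').val := by
        rcases hk01 j with h | h <;> rcases hk01 j' with h' | h' <;> rw [h, h'] at hjj' <;> omega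
      exact he (ZMod.val_injective _ hval)
    refine (sum_prod_gtWeightInt_le hs hγ hN hb hC hF _ hinj (range N')).trans ?_
    refine mul_le_mul_of_nonneg_left ?_ (mul_nonneg (by positivity) (pow_nonneg htc0 s))
    -- dominate every exponential by the pair weight
    have hterm : ∀ r ∈ Fintype.piFinset (fun _ : Fin s => (Finset.univ : Finset (Fin t))),
        C * N * ∑ j : Fin s, ∑ j' : Fin s, (if j < j' then
          Real.exp (C * roughSum w (Int.natAbs ((primorial w : ℤ) *
            ((((e j).val : ℤ) - k j * N') - (((e j').val : ℤ) - k j' * N')) + b (r j) - b (r j'))))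
          else 0) ≤ C * N * PW := by
      intro r _
      refine mul_le_mul_of_nonneg_left (Finset.sum_le_sum fun j _ => Finset.sum_le_sum fun j' _ => ?_)
        (mul_nonneg hC hN0)
      split_ifs
      · obtain ⟨ℓ, hℓ, hℓeq⟩ := exists_lift_of_sub (e j) (e j') (hk01 j) (hk01 j')
        have hrw : (primorial w : ℤ) * ((((e j).val : ℤ) - k j * N') - (((e j').val : ℤ) - k j' * N')) +
            b (r j) - b (r j') =
            (primorial w : ℤ) * ((((e j - e j').val : ℕ) : ℤ) + ℓ * N') + ((b (r j) : ℤ) - b (r j')) := by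
          rw [hℓeq]; ring
        rw [hrw]
        exact (Real.exp_le_exp.mpr (mul_le_mul_of_nonneg_right hCC (roughSum_nonneg _ _))).trans
          (exp_le_corrPairWeight (e j - e j') hℓ (r j) (r j'))
      · exact le_rfl
    calc ∑ r ∈ Fintype.piFinset (fun _ : Fin s => (Finset.univ : Finset (Fin t))),
          C * N * ∑ j : Fin s, ∑ j' : Fin s, (if j < j' then
            Real.exp (C * roughSum w (Int.natAbs ((primorial w : ℤ) *
              ((((e j).val : ℤ) - k j * N') - (((e j').val : ℤ) - k j' * N')) + b (r j) - b (r j'))))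
            else 0)
        ≤ ∑ r ∈ Fintype.piFinset (fun _ : Fin s => (Finset.univ : Finset (Fin t))), C * N * PW :=
          Finset.sum_le_sum hterm
      _ = (t : ℝ) ^ s * (C * N * PW) := by
          rw [Finset.sum_const, Fintype.card_piFinset_const, Finset.card_univ, Fintype.card_fin,
            nsmul_eq_mul]
          push_cast
          ring
  -- Step 3: sum over the `2^s` lift patterns
  have h3 : (1 / ((t : ℝ) * GreenTao2008.cChi χ)) ^ s * (t : ℝ) ^ s = (1 / GreenTao2008.cChi χ) ^ s := by
    rw [← mul_pow]
    congr 1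
    field_simp
  calc ∑ k ∈ Fintype.piFinset (fun _ : Fin s => ({0, 1} : Finset ℤ)),
        ∑ v ∈ range N', ∏ j, gtWeightInt χ γ N w b ((v : ℤ) + (((e j).val : ℤ) - k j * N'))
      ≤ ∑ k ∈ Fintype.piFinset (fun _ : Fin s => ({0, 1} : Finset ℤ)),
          (1 / 2) ^ s * (1 / ((t : ℝ) * GreenTao2008.cChi χ)) ^ s * ((t : ℝ) ^ s * (C * N * PW)) :=
        Finset.sum_le_sum hk
    _ = (2 : ℝ) ^ s * ((1 / 2) ^ s * (1 / ((t : ℝ) * GreenTao2008.cChi χ)) ^ s * ((t : ℝ) ^ s * (C * N * PW))) := by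
        rw [Finset.sum_const, Fintype.card_piFinset_const, Finset.card_pair (by norm_num), nsmul_eq_mul]
        push_cast
        ring
    _ = ((2 : ℝ) ^ s * (1 / 2) ^ s) * ((1 / ((t : ℝ) * GreenTao2008.cChi χ)) ^ s * (t : ℝ) ^ s) *
          (C * N * PW) := by ring
    _ = (1 / GreenTao2008.cChi χ) ^ s * C * N * PW := by
        rw [h3, ← mul_pow]
        norm_num
        ring

/-! ### The case of a single weight factor: the linear forms display with one form -/

/-- The instance of the linear forms display `GreenTao2010_envelopingSieve_linearForms` with one form
`ψ(n) = n` on `ℤ¹` and the body `[1, N]`: `|(φ(W)/W) ∑_{n ∈ [N]} Λ_{χ,R,2}(Wn + b₀) - c (N-1)| ≤ ε N`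
for every admissible residue `b₀`. [cite: GreenTao2010, App. D (proof of Prop. 6.4, display (D.8)
with `m = d = 1`)] -/
def MeanEstimateAt (χ : ℝ → ℝ) (γ : ℝ) (N w : ℕ) (ε : ℝ) : Prop :=
  ∀ b₀ : ℕ, 1 ≤ b₀ → b₀ ≤ primorial w → Nat.Coprime b₀ (primorial w) →
    |(Nat.totient (primorial w) : ℝ) / primorial w *
        ∑ n ∈ Icc 1 N, truncDivisorSum χ ((N : ℝ) ^ γ) 2 ((primorial w : ℤ) * n + b₀) -
      GreenTao2008.cChi χ * ((N : ℝ) - 1)| ≤ ε * N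

/-- The one-form system `ψ(n) = n` on `ℤ¹`. [folklore] -/
def idForm : Fin 1 → AffLinForm 1 := fun _ => ⟨fun _ => 1, 0⟩

/-- `ψ(n) = n₀`. [folklore] -/
theorem idForm_eval (j : Fin 1) (n : Fin 1 → ℤ) : (idForm j).eval n = n 0 := by
  simp [idForm, AffLinForm.eval]

/-- `ψ(x) = x₀` on `ℝ¹`. [folklore] -/
theorem idForm_realEval (j : Fin 1) (x : Fin 1 → ℝ) : (idForm j).realEval x = x 0 := by
  simp [idForm, AffLinForm.realEval]

/-- The one-form system satisfies the standing hypotheses and has finite complexity, and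
`‖Ψ‖_N = 1`. [folklore] -/
theorem idForm_props (N : ℝ) : IsNondegenerateSystem idForm ∧ IsFiniteComplexitySystem idForm ∧
    affLinSize idForm N = 1 := by
  refine ⟨⟨fun i h => ?_, fun i j hij => absurd (Subsingleton.elim i j) hij⟩,
    fun i j hij => absurd (Subsingleton.elim i j) hij, ?_⟩
  · have := congrFun h 0
    simp [idForm] at this
  · simp [affLinSize, idForm]

/-- The body `[1, N]¹ ⊆ ℝ¹`. [folklore] -/
def unitBody (N : ℕ) : Set (Fin 1 → ℝ) := Set.univ.pi fun _ : Fin 1 => Set.Icc (1 : ℝ) N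

/-- `[1,N]¹` is convex, lies in the box, the form is bounded by `N` on it, and its volume is `N - 1`
(for `N ≥ 1`). [folklore] -/
theorem unitBody_props {N : ℕ} (hN : 1 ≤ N) : Convex ℝ (unitBody N) ∧ unitBody N ⊆ realBox 1 N ∧
    (∀ x ∈ unitBody N, ∀ j, |(idForm j).realEval x| ≤ N) ∧
    (MeasureTheory.volume (unitBody N)).toReal = (N : ℝ) - 1 := by
  have hN1 : (1 : ℝ) ≤ N := by exact_mod_cast hN
  refine ⟨convex_pi fun _ _ => convex_Icc _ _, fun x hx => ?_, fun x hx j => ?_, ?_⟩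
  · simp only [unitBody, Set.mem_pi, Set.mem_univ, forall_true_left, Set.mem_Icc] at hx
    simp only [realBox, Set.mem_Icc]
    refine ⟨fun i => ?_, fun i => (hx i).2⟩
    have := (hx i).1
    have hN0 : (0 : ℝ) ≤ N := Nat.cast_nonneg N
    linarith
  · simp only [unitBody, Set.mem_pi, Set.mem_univ, forall_true_left, Set.mem_Icc] at hx
    rw [idForm_realEval, abs_le]
    have := hx 0
    constructor <;> linarith [this.1, this.2]
  · rw [unitBody, MeasureTheory.volume_pi_pi]
    simp only [Real.volume_Icc, Finset.prod_const, Finset.card_univ, Fintype.card_fin, pow_one]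
    exact ENNReal.toReal_ofReal (by linarith)

open Classical in
/-- The lattice points of `[1,N]¹` counted with a weight depending on the single coordinate:
`∑_{n ∈ [1,N]¹ ∩ ℤ¹} f(n₀) = ∑_{v=1}^{N} f(v)`. [folklore] -/
theorem sum_filter_unitBody_eq {N : ℕ} (f : ℤ → ℝ) :
    ∑ n ∈ (latticeBox 1 N).filter (fun n => realPoint n ∈ unitBody N), f (n 0) =
      ∑ v ∈ Icc 1 N, f (v : ℕ) := by
  classical
  refine Finset.sum_nbij' (fun n => (n 0).toNat) (fun v : ℕ => fun _ => (v : ℤ)) ?_ ?_ ?_ ?_ ?_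
  · intro n hn
    obtain ⟨-, hK⟩ := Finset.mem_filter.mp hn
    simp only [unitBody, realPoint, Set.mem_pi, Set.mem_univ, forall_true_left, Set.mem_Icc] at hK
    have h1 : (1 : ℝ) ≤ n 0 := (hK 0).1
    have h2 : ((n 0 : ℤ) : ℝ) ≤ N := (hK 0).2
    have h1' : (1 : ℤ) ≤ n 0 := by exact_mod_cast h1
    have h2' : n 0 ≤ N := by exact_mod_cast h2
    exact Finset.mem_Icc.mpr ⟨by omega, by omega⟩
  · intro v hv
    obtain ⟨h1, h2⟩ := Finset.mem_Icc.mp hv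
    refine Finset.mem_filter.mpr ⟨?_, ?_⟩
    · refine Fintype.mem_piFinset.mpr fun _ => Finset.mem_Icc.mpr ⟨?_, ?_⟩ <;> omega
    · simp only [unitBody, realPoint, Set.mem_pi, Set.mem_univ, forall_true_left, Set.mem_Icc]
      intro _
      exact ⟨by exact_mod_cast h1, by exact_mod_cast h2⟩
  · intro n hn
    obtain ⟨-, hK⟩ := Finset.mem_filter.mp hn
    simp only [unitBody, realPoint, Set.mem_pi, Set.mem_univ, forall_true_left, Set.mem_Icc] at hK
    have h1 : (1 : ℤ) ≤ n 0 := by exact_mod_cast (hK 0).1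
    funext i
    rw [Fin.fin_one_eq_zero i]
    exact Int.toNat_of_nonneg (by omega)
  · intro v _
    simp
  · intro n hn
    obtain ⟨-, hK⟩ := Finset.mem_filter.mp hn
    simp only [unitBody, realPoint, Set.mem_pi, Set.mem_univ, forall_true_left, Set.mem_Icc] at hK
    have h1 : (1 : ℤ) ≤ n 0 := by exact_mod_cast (hK 0).1
    rw [Int.toNat_of_nonneg (by omega)]

/-- The linear forms display supplies `MeanEstimateAt` past its thresholds (instance `D = L = 1`,
`d = m = 1`, `Ψ = (n ↦ n)`, `K = [1,N]¹`). [cite: GreenTao2010, App. D (proof of Prop. 6.4,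
display (D.8))] -/
theorem meanEstimateAt_of_linearForms (hF : GreenTao2010_envelopingSieve_linearForms) {χ : ℝ → ℝ}
    (hχ : IsSmoothCompactCutoff χ) :
    ∃ γ₀ : ℝ, 0 < γ₀ ∧ ∀ γ : ℝ, 0 < γ → γ ≤ γ₀ → ∀ ε : ℝ, 0 < ε → ∃ w₀ N₀ : ℕ,
      ∀ N : ℕ, N₀ ≤ N → 1 ≤ N → ∀ w : ℕ, w₀ ≤ w → (w : ℝ) ≤ Real.log (Real.log N) / 2 →
        MeanEstimateAt χ γ N w ε := by
  classical
  obtain ⟨γ₀, hγ₀, H⟩ := hF 1 1 χ hχ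
  refine ⟨γ₀, hγ₀, fun γ hγ hγle ε hε => ?_⟩
  obtain ⟨w₀, N₀, H'⟩ := H γ hγ hγle ε hε
  refine ⟨w₀, N₀, fun N hN hN1 w hw hwN b₀ hb1 hb2 hb3 => ?_⟩
  obtain ⟨hnd, hfc, hsize⟩ := idForm_props (N : ℝ)
  obtain ⟨hconv, hbox, hbdd, hvol⟩ := unitBody_props hN1
  have h := H' N hN w hw hwN 1 1 le_rfl le_rfl le_rfl le_rfl (fun _ => b₀) (fun _ => ⟨hb1, hb2, hb3⟩)
    idForm hnd hfc (by rw [hsize]; exact_mod_cast le_rfl) (unitBody N) hconv hbox hbdd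
  rw [hvol, pow_one, pow_one, pow_one] at h
  have hsum : ∑ n ∈ (latticeBox 1 N).filter (fun n => realPoint n ∈ unitBody N),
      ∏ j : Fin 1, truncDivisorSum χ ((N : ℝ) ^ γ) 2 ((primorial w : ℤ) * (idForm j).eval n + b₀) =
      ∑ v ∈ Icc 1 N, truncDivisorSum χ ((N : ℝ) ^ γ) 2 ((primorial w : ℤ) * (v : ℕ) + b₀) := by
    simp_rw [Fin.prod_univ_one, idForm_eval]
    exact sum_filter_unitBody_eq (fun z => truncDivisorSum χ ((N : ℝ) ^ γ) 2 ((primorial w : ℤ) * z + b₀))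
  rw [hsum] at h
  exact h

/-- **One weight factor**: from the one-form estimate with error `ε ≤ c`,
`∑_{v=1}^{N} ν̃(v) ≤ 2N`. [cite: GreenTao2010, App. D (proof of Prop. 6.4: "As before we can pass
from `ν` to `ν̃`")] -/
theorem sum_gtPreMeasure_le (ht : 1 ≤ t) (hc : 0 < GreenTao2008.cChi χ)
    (hb : ∀ i, 1 ≤ b i ∧ b i ≤ primorial w ∧ Nat.Coprime (b i) (primorial w))
    {ε : ℝ} (hε : ε ≤ GreenTao2008.cChi χ) (hM : MeanEstimateAt χ γ N w ε) :
    ∑ v ∈ Icc 1 N, gtPreMeasure χ γ N w b v ≤ 2 * N := by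
  have ht0 : (0 : ℝ) < t := by exact_mod_cast ht
  have hN0 : (0 : ℝ) ≤ N := Nat.cast_nonneg N
  have hc' : GreenTao2008.cChi χ ≠ 0 := hc.ne'
  -- `∑_v ν̃(v) = (1/(tc)) ∑_i φW ∑_v Λ(Wv + bᵢ)`
  have hexp : ∑ v ∈ Icc 1 N, gtPreMeasure χ γ N w b v =
      1 / (t * GreenTao2008.cChi χ) * ∑ i, ((Nat.totient (primorial w) : ℝ) / primorial w * ∑ v ∈ Icc 1 N,
        truncDivisorSum χ ((N : ℝ) ^ γ) 2 ((primorial w : ℤ) * (v : ℕ) + b i)) := by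
    unfold gtPreMeasure
    rw [Finset.mul_sum]
    simp_rw [Finset.mul_sum]
    rw [Finset.sum_comm]
    refine Finset.sum_congr rfl fun i _ => Finset.sum_congr rfl fun v _ => ?_
    field_simp
  rw [hexp]
  have hi : ∀ i, (Nat.totient (primorial w) : ℝ) / primorial w *
      ∑ v ∈ Icc 1 N, truncDivisorSum χ ((N : ℝ) ^ γ) 2 ((primorial w : ℤ) * (v : ℕ) + b i)
      ≤ 2 * GreenTao2008.cChi χ * N := by
    intro i
    have h := hM (b i) (hb i).1 (hb i).2.1 (hb i).2.2
    have h1 := (abs_le.mp h).2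
    nlinarith
  calc 1 / (t * GreenTao2008.cChi χ) * ∑ i, ((Nat.totient (primorial w) : ℝ) / primorial w * ∑ v ∈ Icc 1 N,
        truncDivisorSum χ ((N : ℝ) ^ γ) 2 ((primorial w : ℤ) * (v : ℕ) + b i))
      ≤ 1 / (t * GreenTao2008.cChi χ) * ∑ i : Fin t, 2 * GreenTao2008.cChi χ * N :=
        mul_le_mul_of_nonneg_left (Finset.sum_le_sum fun i _ => hi i) (by positivity)
    _ = 2 * N := by
        rw [Finset.sum_const, Finset.card_univ, Fintype.card_fin, nsmul_eq_mul]
        field_simp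

/-- The sum of the single weight factor over `ℤ_{N'}`: `∑_{n} g₁(n + h) = ½ ∑_{v=1}^{N} ν̃(v)`
(translation invariance and unwrapping). [folklore] -/
theorem sum_gtWeightPart_shift_eq {N' : ℕ} [NeZero N'] (hNN' : N < N') (h : ZMod N') :
    ∑ n : ZMod N', gtWeightPart χ γ N w b N' (n + h) =
      1 / 2 * ∑ v ∈ Icc 1 N, gtPreMeasure χ γ N w b v := by
  classical
  rw [show (∑ n : ZMod N', gtWeightPart χ γ N w b N' (n + h)) =
      ∑ n : ZMod N', gtWeightPart χ γ N w b N' n from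
    Fintype.sum_equiv (Equiv.addRight h) _ _ fun _ => rfl]
  rw [Literature.NumberTheory.LFunctions.sum_zmod_eq_sum_range, Finset.mul_sum]
  -- the terms with `v ∈ [1, N]` survive
  have hterm : ∀ v ∈ range N', gtWeightPart χ γ N w b N' (v : ZMod N') =
      if v ∈ Icc 1 N then 1 / 2 * gtPreMeasure χ γ N w b v else 0 := by
    intro v hv
    unfold gtWeightPart
    rw [ZMod.val_natCast_of_lt (Finset.mem_range.mp hv)]
    simp only [Finset.mem_Icc]
    split_ifs <;> ring
  rw [Finset.sum_congr rfl hterm, ← Finset.sum_filter]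
  congr 1
  ext v
  simp only [Finset.mem_filter, Finset.mem_range, Finset.mem_Icc]
  omega

/-! ### The coincident case: crude divisor bounds -/

/-- AM–GM and translation invariance: `∑_n ∏ᵢ ν(n + hᵢ) ≤ ∑_n ν(n)^m`. [folklore] -/
theorem sum_prod_shift_le_sum_pow {N' : ℕ} [NeZero N'] {m : ℕ} (hm : 1 ≤ m) (ν : ZMod N' → ℝ)
    (hν : ∀ x, 0 ≤ ν x) (h : Fin m → ZMod N') :
    ∑ n : ZMod N', ∏ i, ν (n + h i) ≤ ∑ n : ZMod N', ν n ^ m := by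
  have hm0 : (0 : ℝ) < m := by exact_mod_cast hm
  calc ∑ n : ZMod N', ∏ i, ν (n + h i)
      ≤ ∑ n : ZMod N', (1 / (m : ℝ)) * ∑ i, ν (n + h i) ^ m :=
        Finset.sum_le_sum fun n _ => prod_le_avg_pow hm fun i => hν _
    _ = (1 / (m : ℝ)) * ∑ i : Fin m, ∑ n : ZMod N', ν (n + h i) ^ m := by
        rw [← Finset.mul_sum, Finset.sum_comm]
    _ = (1 / (m : ℝ)) * ∑ i : Fin m, ∑ n : ZMod N', ν n ^ m := by
        congr 1
        refine Finset.sum_congr rfl fun i _ => ?_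
        exact Fintype.sum_equiv (Equiv.addRight (h i)) _ _ fun _ => rfl
    _ = ∑ n : ZMod N', ν n ^ m := by
        rw [Finset.sum_const, Finset.card_univ, Fintype.card_fin, nsmul_eq_mul]
        field_simp

/-- Convexity of `t ↦ t^m` at the two points `1` and `a ≥ 0`: `(½ + ½a)^m ≤ ½ + ½ a^m`. [folklore] -/
theorem half_add_half_pow_le {a : ℝ} (ha : 0 ≤ a) (m : ℕ) : (1 / 2 + a / 2) ^ m ≤ 1 / 2 + a ^ m / 2 := by
  induction m with
  | zero => norm_num
  | succ m ih =>
    have hkey : 0 ≤ (1 - a) * (1 - a ^ m) := by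
      rcases le_or_gt a 1 with h | h
      · exact mul_nonneg (by linarith) (by linarith [pow_le_one₀ (n := m) ha h])
      · have : 1 ≤ a ^ m := one_le_pow₀ h.le
        exact mul_nonneg_of_nonpos_of_nonpos (by linarith) (by linarith)
    have h0 : 0 ≤ 1 / 2 + a / 2 := by positivity
    calc (1 / 2 + a / 2) ^ (m + 1) = (1 / 2 + a / 2) ^ m * (1 / 2 + a / 2) := pow_succ _ _
      _ ≤ (1 / 2 + a ^ m / 2) * (1 / 2 + a / 2) := mul_le_mul_of_nonneg_right ih h0
      _ ≤ 1 / 2 + a ^ (m + 1) / 2 := by rw [pow_succ]; nlinarith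

/-- `∑_x ν(x)^m ≤ N' + ½ ∑_{v=1}^{N} ν̃(v)^m`. [folklore] -/
theorem sum_gtMeasure_pow_le {N' : ℕ} [NeZero N'] (hNN' : N < N') (hγ : 0 ≤ γ) (hN : 1 ≤ N) (m : ℕ) :
    ∑ x : ZMod N', gtMeasure χ γ N w b N' x ^ m ≤
      N' + 1 / 2 * ∑ v ∈ Icc 1 N, gtPreMeasure χ γ N w b v ^ m := by
  classical
  rw [Literature.NumberTheory.LFunctions.sum_zmod_eq_sum_range]
  have hterm : ∀ v ∈ range N', gtMeasure χ γ N w b N' (v : ZMod N') ^ m ≤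
      1 + (if v ∈ Icc 1 N then 1 / 2 * gtPreMeasure χ γ N w b v ^ m else 0) := by
    intro v hv
    unfold gtMeasure
    rw [ZMod.val_natCast_of_lt (Finset.mem_range.mp hv)]
    by_cases h1 : 1 ≤ v ∧ v ≤ N
    · rw [if_pos h1, if_pos (Finset.mem_Icc.mpr h1)]
      have hpre := gtPreMeasure_nonneg χ hγ hN w b (v : ℤ)
      have h2 := half_add_half_pow_le hpre m
      have h3 : (1 / 2 + gtPreMeasure χ γ N w b (v : ℤ) / 2) ^ m ≤ 1 + 1 / 2 * gtPreMeasure χ γ N w b (v : ℤ) ^ m := by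
        linarith [pow_nonneg hpre m]
      exact h3
    · rw [if_neg h1, if_neg (fun h => h1 (Finset.mem_Icc.mp h)), one_pow, add_zero]
  refine (Finset.sum_le_sum hterm).trans (le_of_eq ?_)
  rw [Finset.sum_add_distrib, Finset.sum_const, Finset.card_range, nsmul_eq_mul, mul_one,
    ← Finset.sum_filter, Finset.mul_sum]
  congr 1
  refine Finset.sum_congr ?_ fun _ _ => rfl
  ext v
  simp only [Finset.mem_filter, Finset.mem_range, Finset.mem_Icc]
  omega

/-- `φ(W)/W ≤ 1`. [folklore] -/
theorem totient_div_le_one (W : ℕ) : (Nat.totient W : ℝ) / W ≤ 1 := by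
  rcases Nat.eq_zero_or_pos W with rfl | hW
  · simp
  · rw [div_le_one (by exact_mod_cast hW)]
    exact_mod_cast Nat.totient_le W

/-- **Crude moments of `ν̃`**: `∑_{v=1}^{N} ν̃(v)^m ≤ c^{-m} (log R)^m B^{2m} (N (1 + log ⌊R⌋)^{f(2m,0)} + ⌊R⌋^{2m})`
(`ν̃ ≤ (tc)^{-1} ∑ᵢ Λ_{χ,R,2}(Wv + bᵢ)`, a power mean over `i`, and `sum_truncDivisorSum_two_pow_le`).
[cite: GreenTao2010, App. D (proof of Prop. 6.4: "crude divisor estimates")] -/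
theorem sum_gtPreMeasure_pow_le (ht : 1 ≤ t) (hc : 0 < GreenTao2008.cChi χ) (hγ : 0 ≤ γ)
    (hN : 1 ≤ N) {B : ℝ} (hB : ∀ x, |χ x| ≤ B)
    (hb : ∀ i, 1 ≤ b i ∧ b i ≤ primorial w ∧ Nat.Coprime (b i) (primorial w)) {m : ℕ} (hm : 1 ≤ m) :
    ∑ v ∈ Icc 1 N, gtPreMeasure χ γ N w b v ^ m ≤
      (1 / GreenTao2008.cChi χ) ^ m * (Real.log ((N : ℝ) ^ γ) ^ m * B ^ (2 * m) *
        (N * (1 + Real.log ⌊(N : ℝ) ^ γ⌋₊) ^ (lcmLogExp (2 * m) 0) + (⌊(N : ℝ) ^ γ⌋₊ : ℝ) ^ (2 * m))) := by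
  set c : ℝ := GreenTao2008.cChi χ with hcdef
  have hc0 : 0 < c := hc
  have hc' : c ≠ 0 := hc.ne'
  set W : ℕ := primorial w with hW
  set R : ℝ := (N : ℝ) ^ γ with hR
  set Bound : ℝ := Real.log R ^ m * B ^ (2 * m) *
    (N * (1 + Real.log ⌊R⌋₊) ^ (lcmLogExp (2 * m) 0) + (⌊R⌋₊ : ℝ) ^ (2 * m)) with hBound
  have hR1 : 1 ≤ R := one_le_rpow_level hN hγ
  have hW1 : 1 ≤ W := primorial_pos w
  have ht0 : (0 : ℝ) < t := by exact_mod_cast ht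
  obtain ⟨m', rfl⟩ : ∃ m', m = m' + 1 := ⟨m - 1, by omega⟩
  have hΛ0 : ∀ y : ℤ, 0 ≤ truncDivisorSum χ R 2 y := fun y => truncDivisorSum_two_nonneg χ hR1 y
  -- pointwise: `ν̃(v)^m ≤ (1/(tc))^m t^{m-1} ∑ᵢ Λ(Wv + bᵢ)^m`
  have hpt : ∀ v : ℕ, gtPreMeasure χ γ N w b v ^ (m' + 1) ≤
      (1 / ((t : ℝ) * c)) ^ (m' + 1) * ((t : ℝ) ^ m' *
        ∑ i, truncDivisorSum χ R 2 ((W : ℤ) * (v : ℕ) + b i) ^ (m' + 1)) := by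
    intro v
    unfold gtPreMeasure
    rw [mul_pow]
    have hS0 : 0 ≤ ∑ i, truncDivisorSum χ R 2 ((W : ℤ) * (v : ℕ) + b i) :=
      Finset.sum_nonneg fun i _ => hΛ0 _
    refine mul_le_mul ?_ ?_ (pow_nonneg hS0 _) (by positivity)
    · refine pow_le_pow_left₀ (by positivity) ?_ _
      rw [div_le_div_iff_of_pos_right (by positivity)]
      exact totient_div_le_one W
    · have h := pow_sum_le_card_mul_sum_pow (s := (Finset.univ : Finset (Fin t)))
        (f := fun i => truncDivisorSum χ R 2 ((W : ℤ) * (v : ℕ) + b i)) (fun i _ => hΛ0 _) m'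
      rw [Finset.card_univ, Fintype.card_fin] at h
      exact h
  -- sum over `v`, swap, and apply the progression moment bound for each residue
  have hsum : ∀ i, ∑ v ∈ Icc 1 N, truncDivisorSum χ R 2 ((W : ℤ) * (v : ℕ) + b i) ^ (m' + 1) ≤ Bound :=
    fun i => sum_truncDivisorSum_two_pow_le hB hR1 (hb i).2.2 hW1 N (m' + 1)
  calc ∑ v ∈ Icc 1 N, gtPreMeasure χ γ N w b v ^ (m' + 1)
      ≤ ∑ v ∈ Icc 1 N, (1 / ((t : ℝ) * c)) ^ (m' + 1) * ((t : ℝ) ^ m' *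
          ∑ i, truncDivisorSum χ R 2 ((W : ℤ) * (v : ℕ) + b i) ^ (m' + 1)) :=
        Finset.sum_le_sum fun v _ => hpt v
    _ = (1 / ((t : ℝ) * c)) ^ (m' + 1) * (t : ℝ) ^ m' *
          ∑ i, ∑ v ∈ Icc 1 N, truncDivisorSum χ R 2 ((W : ℤ) * (v : ℕ) + b i) ^ (m' + 1) := by
        rw [← Finset.mul_sum, ← Finset.mul_sum, Finset.sum_comm, mul_assoc]
    _ ≤ (1 / ((t : ℝ) * c)) ^ (m' + 1) * (t : ℝ) ^ m' * ∑ i : Fin t, Bound := by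
        refine mul_le_mul_of_nonneg_left (Finset.sum_le_sum fun i _ => hsum i) (by positivity)
    _ = (1 / c) ^ (m' + 1) * Bound := by
        rw [Finset.sum_const, Finset.card_univ, Fintype.card_fin, nsmul_eq_mul]
        have : (1 / ((t : ℝ) * c)) ^ (m' + 1) * (t : ℝ) ^ m' * (t : ℝ) = (1 / c) ^ (m' + 1) := by
          rw [mul_assoc, ← pow_succ, ← mul_pow]
          congr 1
          field_simp
        rw [← mul_assoc, this]

/-- **The crude bound, simplified**: for `0 ≤ γ ≤ 1`, `2mγ ≤ 1`, `N ≥ 1`,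
`(log R)^m B^{2m} (N (1 + log ⌊R⌋)^f + ⌊R⌋^{2m}) ≤ 2 B^{2m} (1 + log N)^{m+f} N` (`R = N^γ ≤ N`,
`R^{2m} ≤ N`). [folklore] -/
theorem crudeBound_le {γ : ℝ} (hγ : 0 ≤ γ) (hγ1 : γ ≤ 1) {m : ℕ} (hmγ : 2 * m * γ ≤ 1) {N : ℕ}
    (hN : 1 ≤ N) {B : ℝ} (hB0 : 0 ≤ B) (f : ℕ) :
    Real.log ((N : ℝ) ^ γ) ^ m * B ^ (2 * m) *
        (N * (1 + Real.log ⌊(N : ℝ) ^ γ⌋₊) ^ f + (⌊(N : ℝ) ^ γ⌋₊ : ℝ) ^ (2 * m)) ≤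
      2 * B ^ (2 * m) * (1 + Real.log N) ^ (m + f) * N := by
  have hN1 : (1 : ℝ) ≤ N := by exact_mod_cast hN
  have hN0 : (0 : ℝ) < N := by linarith
  set R : ℝ := (N : ℝ) ^ γ with hR
  have hR1 : 1 ≤ R := Real.one_le_rpow hN1 hγ
  have hRN : R ≤ N := by
    have := Real.rpow_le_rpow_of_exponent_le hN1 hγ1
    rwa [Real.rpow_one] at this
  have hlogN : 0 ≤ Real.log N := Real.log_nonneg hN1
  set L : ℝ := 1 + Real.log N with hL
  have hL1 : 1 ≤ L := by rw [hL]; linarith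
  -- `log R ≤ L`
  have hlogR : Real.log R ≤ L := by
    rw [hR, Real.log_rpow hN0, hL]; nlinarith
  have hlogR0 : 0 ≤ Real.log R := Real.log_nonneg hR1
  -- `1 + log ⌊R⌋ ≤ L`
  have hfl1 : 1 ≤ ⌊R⌋₊ := Nat.le_floor (by exact_mod_cast hR1)
  have hflN : (⌊R⌋₊ : ℝ) ≤ N := by
    have : ⌊R⌋₊ ≤ ⌊(N : ℝ)⌋₊ := Nat.floor_le_floor hRN
    rw [Nat.floor_natCast] at this
    exact_mod_cast this
  have hlogfl : 1 + Real.log ⌊R⌋₊ ≤ L := by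
    rw [hL]
    have : Real.log ⌊R⌋₊ ≤ Real.log N := Real.log_le_log (by exact_mod_cast hfl1) hflN
    linarith
  have hlogfl0 : 0 ≤ 1 + Real.log ⌊R⌋₊ := by
    have : 0 ≤ Real.log ⌊R⌋₊ := Real.log_nonneg (by exact_mod_cast hfl1)
    linarith
  -- `⌊R⌋^{2m} ≤ N`
  have hflpow : (⌊R⌋₊ : ℝ) ^ (2 * m) ≤ N := by
    have h1 : (⌊R⌋₊ : ℝ) ^ (2 * m) ≤ R ^ (2 * m) :=
      pow_le_pow_left₀ (Nat.cast_nonneg _) (Nat.floor_le (by linarith)) _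
    have h2 : R ^ (2 * m) = (N : ℝ) ^ (γ * (2 * m)) := by
      rw [hR, ← Real.rpow_natCast, ← Real.rpow_mul hN0.le]; push_cast; ring_nf
    have h3 : (N : ℝ) ^ (γ * (2 * m)) ≤ (N : ℝ) ^ (1 : ℝ) :=
      Real.rpow_le_rpow_of_exponent_le hN1 (by nlinarith)
    rw [Real.rpow_one] at h3
    linarith
  -- assemble
  have hB2 : 0 ≤ B ^ (2 * m) := pow_nonneg hB0 _
  have hLm : Real.log R ^ m ≤ L ^ m := pow_le_pow_left₀ hlogR0 hlogR m
  have hLf : (1 + Real.log ⌊R⌋₊) ^ f ≤ L ^ f := pow_le_pow_left₀ hlogfl0 hlogfl f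
  have hLf1 : 1 ≤ L ^ f := one_le_pow₀ hL1
  calc Real.log R ^ m * B ^ (2 * m) * (N * (1 + Real.log ⌊R⌋₊) ^ f + (⌊R⌋₊ : ℝ) ^ (2 * m))
      ≤ L ^ m * B ^ (2 * m) * (N * L ^ f + N) := by
        refine mul_le_mul (mul_le_mul_of_nonneg_right hLm hB2) (add_le_add
          (mul_le_mul_of_nonneg_left hLf hN0.le) hflpow) (by positivity) (by positivity)
    _ ≤ L ^ m * B ^ (2 * m) * (N * L ^ f + N * L ^ f) := by
        refine mul_le_mul_of_nonneg_left (add_le_add le_rfl ?_) (by positivity)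
        nlinarith
    _ = 2 * B ^ (2 * m) * L ^ (m + f) * N := by rw [pow_add]; ring

/-- The coincident bound `T₀ = 1 + c^{-m} B^{2m} (1 + log N)^{m + f(2m,0)}` ("setting `τ(0)` to be
moderately large"). [cite: GreenTao2010, App. D (proof of Prop. 6.4, the coincident case)] -/
def coincidentBound (c B : ℝ) (m N : ℕ) : ℝ :=
  1 + (1 / c) ^ m * B ^ (2 * m) * (1 + Real.log N) ^ (m + lcmLogExp (2 * m) 0)

/-- `T₀ ≥ 0` for `c > 0`, `B ≥ 0`, `N ≥ 1`. [folklore] -/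
theorem coincidentBound_nonneg {c B : ℝ} (hc : 0 < c) (hB : 0 ≤ B) (m : ℕ) {N : ℕ} (hN : 1 ≤ N) :
    0 ≤ coincidentBound c B m N := by
  unfold coincidentBound
  have : 0 ≤ 1 + Real.log N := by
    have : 0 ≤ Real.log N := Real.log_nonneg (by exact_mod_cast hN)
    linarith
  positivity

/-- **The coincident case**: `𝔼_n ν(n)^m ≤ T₀` ("one can use crude divisor estimates").
[cite: GreenTao2010, App. D (proof of Prop. 6.4, the coincident case)] -/
theorem sum_gtMeasure_pow_div_le (ht : 1 ≤ t) (hc : 0 < GreenTao2008.cChi χ) (hγ : 0 ≤ γ)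
    (hγ1 : γ ≤ 1) {m : ℕ} (hm : 1 ≤ m) (hmγ : 2 * m * γ ≤ 1) (hN : 1 ≤ N) {B : ℝ} (hB : ∀ x, |χ x| ≤ B)
    (hb : ∀ i, 1 ≤ b i ∧ b i ≤ primorial w ∧ Nat.Coprime (b i) (primorial w))
    {N' : ℕ} [NeZero N'] (hNN' : N < N') :
    (∑ x : ZMod N', gtMeasure χ γ N w b N' x ^ m) / N' ≤ coincidentBound (GreenTao2008.cChi χ) B m N := by
  set c : ℝ := GreenTao2008.cChi χ with hcdef
  have hc0 : 0 < c := hc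
  have hc' : c ≠ 0 := hc.ne'
  have hB0 : 0 ≤ B := (abs_nonneg _).trans (hB 0)
  have hN'pos : (0 : ℝ) < N' := by exact_mod_cast (show 0 < N' by omega)
  have hNN'r : (N : ℝ) ≤ N' := by exact_mod_cast hNN'.le
  have h1 := sum_gtMeasure_pow_le (χ := χ) (w := w) (b := b) hNN' hγ hN m
  have h2 := sum_gtPreMeasure_pow_le ht hc hγ hN hB hb hm
  have h3 := crudeBound_le hγ hγ1 hmγ hN hB0 (lcmLogExp (2 * m) 0)
  set K : ℝ := (1 / c) ^ m * B ^ (2 * m) * (1 + Real.log N) ^ (m + lcmLogExp (2 * m) 0) with hK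
  have hK0 : 0 ≤ K := by
    have : 0 ≤ 1 + Real.log N := by
      have : 0 ≤ Real.log N := Real.log_nonneg (by exact_mod_cast hN); linarith
    positivity
  have hmain : ∑ x : ZMod N', gtMeasure χ γ N w b N' x ^ m ≤ N' + K * N := by
    have hcm : 0 ≤ (1 / c) ^ m := by positivity
    have := mul_le_mul_of_nonneg_left h3 hcm
    nlinarith
  rw [div_le_iff₀ hN'pos]
  unfold coincidentBound
  rw [← hK]
  nlinarith

/-! ### The weight `τ` and its moments -/

/-- Green–Tao's weight on `ℤ_{N'}` for the correlation condition of `ν`, in the pair-matched form: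
`τ(x) = 2^D + 1_{x = 0} T₀ + T₁ e(x)` — the constant absorbs the subsets with at most one weight
factor, `T₀` is the coincident bound ("setting `τ(0)` to be moderately large"), and `e` is the
pair weight dominating every term of the correlation display.
[cite: GreenTao2010, App. D (proof of Prop. 6.4, definition of `τ`)] -/
def gtTau (D : ℕ) (c B Cₑ T₁ : ℝ) (m N w : ℕ) (b : Fin t → ℕ) (N' : ℕ) (x : ZMod N') : ℝ :=
  (2 : ℝ) ^ D + (if x = 0 then coincidentBound c B m N else 0) + T₁ * corrPairWeight Cₑ w b N' x

/-- The moment constants `A(m, q)` of the correlation condition for `ν` (explicit; any bound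
uniform in `N, w, b, N'` would do). [folklore] -/
def gtMomentConst (D t : ℕ) (c B Cₑ T₁ : ℝ) (m : ℕ) (q : ℝ) : ℝ :=
  4 ^ (q - 1) * (((2 : ℝ) ^ D) ^ q +
    2 ^ (q - 1) * (1 + ((1 / c) ^ m * B ^ (2 * m)) ^ q *
      (1 + (m + lcmLogExp (2 * m) 0 : ℝ) * q) ^ ((m + lcmLogExp (2 * m) 0 : ℝ) * q)) +
    T₁ ^ q * ((4 * (t : ℝ) ^ 2) ^ q * (24 * Real.exp (q * Cₑ * ⌈(2 * (q * Cₑ)) ^ 4⌉₊))))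

/-- Two-term power mean: `(a + b)^q ≤ 2^{q-1} (a^q + b^q)`. [folklore] -/
theorem add_rpow_le_two_rpow_mul {a b : ℝ} (ha : 0 ≤ a) (hb : 0 ≤ b) {q : ℝ} (hq : 1 ≤ q) :
    (a + b) ^ q ≤ (2 : ℝ) ^ (q - 1) * (a ^ q + b ^ q) := by
  have h := Real.rpow_sum_le_const_mul_sum_rpow_of_nonneg ({0, 1} : Finset ℕ) hq
    (f := fun i => if i = 0 then a else b) (fun i _ => by split_ifs <;> assumption)
  rw [Finset.sum_pair (by norm_num), Finset.sum_pair (by norm_num), Finset.card_pair (by norm_num)] at h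
  simpa using h

/-- `τ ≥ 0`. [folklore] -/
theorem gtTau_nonneg {D : ℕ} {c B Cₑ T₁ : ℝ} (hc : 0 < c) (hB : 0 ≤ B) (hT₁ : 0 ≤ T₁) (m : ℕ)
    {N : ℕ} (hN : 1 ≤ N) (w : ℕ) (b : Fin t → ℕ) (N' : ℕ) (x : ZMod N') :
    0 ≤ gtTau D c B Cₑ T₁ m N w b N' x := by
  unfold gtTau
  have h1 : 0 ≤ (if x = 0 then coincidentBound c B m N else 0) := by
    split_ifs
    · exact coincidentBound_nonneg hc hB m hN
    · exact le_rfl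
  have h2 : 0 ≤ T₁ * corrPairWeight Cₑ w b N' x := mul_nonneg hT₁ (corrPairWeight_nonneg _ _ _ _ _)
  positivity

/-- **Moments of `τ`** (Def. 6.3: "`𝔼_{n ∈ ℤ_{N'}} τ^q(n) ≪_{m,q} 1`"), uniformly in `N ≥ 2`,
`w ≤ ½ log log N`, `N' ≥ N + 1` and the residues: `𝔼 τ^q ≤ A(m,q)`.
[cite: GreenTao2010, App. D (end of the proof of Prop. 6.4) and Def. 6.3] -/
theorem sum_gtTau_rpow_div_le {D : ℕ} {c B Cₑ T₁ : ℝ} (hc : 0 < c) (hB : 0 ≤ B) (hCₑ : 0 ≤ Cₑ)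
    (hT₁ : 0 ≤ T₁) (ht : 1 ≤ t) (m : ℕ) {q : ℝ} (hq : 1 ≤ q) {N w N' : ℕ} [NeZero N'] (hN : 2 ≤ N)
    (hw : (w : ℝ) ≤ Real.log (Real.log N) / 2) (hNN' : N < N') {b : Fin t → ℕ}
    (hb : ∀ i, 1 ≤ b i ∧ b i ≤ primorial w) :
    (∑ x : ZMod N', gtTau D c B Cₑ T₁ m N w b N' x ^ q) / N' ≤ gtMomentConst D t c B Cₑ T₁ m q := by
  have hN1 : 1 ≤ N := by omega
  have hN1r : (1 : ℝ) ≤ N := by exact_mod_cast hN1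
  have hN'pos : (0 : ℝ) < N' := by exact_mod_cast (show 0 < N' by omega)
  have hNN'r : (N : ℝ) ≤ N' := by exact_mod_cast hNN'.le
  have hq0 : 0 < q := by linarith
  have hq1 : 0 ≤ q - 1 := by linarith
  set T₀ : ℝ := coincidentBound c B m N with hT₀
  have hT₀0 : 0 ≤ T₀ := coincidentBound_nonneg hc hB m hN1
  set a₁ : ℝ := (2 : ℝ) ^ D with ha₁
  have ha₁0 : 0 ≤ a₁ := by positivity
  -- pointwise power mean with three terms
  have hpt : ∀ x : ZMod N', gtTau D c B Cₑ T₁ m N w b N' x ^ q ≤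
      (4 : ℝ) ^ (q - 1) * (a₁ ^ q + (if x = 0 then T₀ else 0) ^ q + (T₁ * corrPairWeight Cₑ w b N' x) ^ q) := by
    intro x
    have hi : 0 ≤ (if x = 0 then T₀ else 0) := by split_ifs <;> [exact hT₀0; exact le_rfl]
    have hp : 0 ≤ T₁ * corrPairWeight Cₑ w b N' x := mul_nonneg hT₁ (corrPairWeight_nonneg _ _ _ _ _)
    unfold gtTau
    rw [← hT₀, ← ha₁]
    have h1 := add_rpow_le_two_rpow_mul (add_nonneg ha₁0 hi) hp hq
    have h2 := add_rpow_le_two_rpow_mul ha₁0 hi hq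
    have h22 : (2 : ℝ) ^ (q - 1) * (2 : ℝ) ^ (q - 1) = (4 : ℝ) ^ (q - 1) := by
      rw [← Real.mul_rpow (by norm_num) (by norm_num)]; norm_num
    have h21 : 1 ≤ (2 : ℝ) ^ (q - 1) := Real.one_le_rpow (by norm_num) hq1
    have hx3 : 0 ≤ (T₁ * corrPairWeight Cₑ w b N' x) ^ q := Real.rpow_nonneg hp q
    calc (a₁ + (if x = 0 then T₀ else 0) + T₁ * corrPairWeight Cₑ w b N' x) ^ q
        ≤ (2 : ℝ) ^ (q - 1) * ((a₁ + (if x = 0 then T₀ else 0)) ^ q + (T₁ * corrPairWeight Cₑ w b N' x) ^ q) := h1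
      _ ≤ (2 : ℝ) ^ (q - 1) * ((2 : ℝ) ^ (q - 1) * (a₁ ^ q + (if x = 0 then T₀ else 0) ^ q) +
            (2 : ℝ) ^ (q - 1) * (T₁ * corrPairWeight Cₑ w b N' x) ^ q) := by
          refine mul_le_mul_of_nonneg_left (add_le_add h2 ?_) (by positivity)
          nlinarith
      _ = (4 : ℝ) ^ (q - 1) * (a₁ ^ q + (if x = 0 then T₀ else 0) ^ q + (T₁ * corrPairWeight Cₑ w b N' x) ^ q) := by
          rw [← h22]; ring
  -- the three sums
  have hs1 : (∑ x : ZMod N', a₁ ^ q) / N' = a₁ ^ q := by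
    rw [Finset.sum_const, Finset.card_univ, ZMod.card, nsmul_eq_mul]
    field_simp
  have hs2 : (∑ x : ZMod N', (if x = 0 then T₀ else 0) ^ q) / N' ≤
      2 ^ (q - 1) * (1 + ((1 / c) ^ m * B ^ (2 * m)) ^ q *
        (1 + (m + lcmLogExp (2 * m) 0 : ℝ) * q) ^ ((m + lcmLogExp (2 * m) 0 : ℝ) * q)) := by
    have hsum : ∑ x : ZMod N', (if x = 0 then T₀ else 0) ^ q = T₀ ^ q := by
      rw [Finset.sum_eq_single (0 : ZMod N')]
      · simp
      · intro x _ hx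
        rw [if_neg hx, Real.zero_rpow hq0.ne']
      · intro h; exact absurd (Finset.mem_univ _) h
    rw [hsum]
    -- `T₀^q ≤ 2^{q-1}(1 + K^q (1+log N)^{eq})`, `(1+log N)^{eq} ≤ (1+eq)^{eq} N`
    set K : ℝ := (1 / c) ^ m * B ^ (2 * m) with hK
    have hK0 : 0 ≤ K := by positivity
    set e : ℝ := (m + lcmLogExp (2 * m) 0 : ℝ) with he
    have he0 : 0 ≤ e := by positivity
    have hL0 : 0 ≤ 1 + Real.log N := by
      have : 0 ≤ Real.log N := Real.log_nonneg hN1r; linarith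
    have hT₀eq : T₀ = 1 + K * (1 + Real.log N) ^ e := by
      rw [hT₀, coincidentBound, hK, he, ← Nat.cast_add, Real.rpow_natCast]
    have h1 : T₀ ^ q ≤ 2 ^ (q - 1) * (1 + (K * (1 + Real.log N) ^ e) ^ q) := by
      rw [hT₀eq]
      have := add_rpow_le_two_rpow_mul zero_le_one (by positivity : 0 ≤ K * (1 + Real.log N) ^ e) hq
      rwa [Real.one_rpow] at this
    have h2 : (K * (1 + Real.log N) ^ e) ^ q = K ^ q * (1 + Real.log N) ^ (e * q) := by
      rw [Real.mul_rpow hK0 (by positivity), ← Real.rpow_mul hL0]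
    have h3 : (1 + Real.log N) ^ (e * q) ≤ (1 + e * q) ^ (e * q) * N :=
      one_add_log_rpow_le hN1r (by positivity)
    have h4 : T₀ ^ q ≤ 2 ^ (q - 1) * (1 + K ^ q * ((1 + e * q) ^ (e * q) * N)) := by
      rw [h2] at h1
      refine h1.trans (mul_le_mul_of_nonneg_left (add_le_add le_rfl ?_) (by positivity))
      exact mul_le_mul_of_nonneg_left h3 (by positivity)
    rw [div_le_iff₀ hN'pos]
    have hN'1 : (1 : ℝ) ≤ N' := by linarith
    set P : ℝ := (2 : ℝ) ^ (q - 1) with hP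
    have hP0 : 0 ≤ P := Real.rpow_nonneg (by norm_num) _
    set Q' : ℝ := K ^ q * (1 + e * q) ^ (e * q) with hQ'
    have hQ'0 : 0 ≤ Q' := by positivity
    have h5 : T₀ ^ q ≤ P * (1 + Q' * N) := h4.trans (le_of_eq (by rw [hQ']; ring))
    calc T₀ ^ q ≤ P * (1 + Q' * N) := h5
      _ = P + P * Q' * N := by ring
      _ ≤ P * N' + P * Q' * N' :=
          add_le_add (le_mul_of_one_le_right hP0 hN'1) (mul_le_mul_of_nonneg_left hNN'r (mul_nonneg hP0 hQ'0))
      _ = P * (1 + Q') * N' := by ring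
  have hs3 : (∑ x : ZMod N', (T₁ * corrPairWeight Cₑ w b N' x) ^ q) / N' ≤
      T₁ ^ q * ((4 * (t : ℝ) ^ 2) ^ q * (24 * Real.exp (q * Cₑ * ⌈(2 * (q * Cₑ)) ^ 4⌉₊))) := by
    have h1 : ∑ x : ZMod N', (T₁ * corrPairWeight Cₑ w b N' x) ^ q = T₁ ^ q * ∑ x : ZMod N', corrPairWeight Cₑ w b N' x ^ q := by
      rw [Finset.mul_sum]
      refine Finset.sum_congr rfl fun x _ => Real.mul_rpow hT₁ (corrPairWeight_nonneg _ _ _ _ _)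
    rw [h1, mul_div_assoc]
    exact mul_le_mul_of_nonneg_left (sum_corrPairWeight_rpow_div_le hCₑ hq ht hN hw hNN'.le hb)
      (Real.rpow_nonneg hT₁ q)
  -- combine
  calc (∑ x : ZMod N', gtTau D c B Cₑ T₁ m N w b N' x ^ q) / N'
      ≤ (∑ x : ZMod N', (4 : ℝ) ^ (q - 1) *
          (a₁ ^ q + (if x = 0 then T₀ else 0) ^ q + (T₁ * corrPairWeight Cₑ w b N' x) ^ q)) / N' :=
        div_le_div_of_nonneg_right (Finset.sum_le_sum fun x _ => hpt x) hN'pos.le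
    _ = (4 : ℝ) ^ (q - 1) * ((∑ x : ZMod N', a₁ ^ q) / N' +
          (∑ x : ZMod N', (if x = 0 then T₀ else 0) ^ q) / N' +
          (∑ x : ZMod N', (T₁ * corrPairWeight Cₑ w b N' x) ^ q) / N') := by
        rw [← Finset.mul_sum, Finset.sum_add_distrib, Finset.sum_add_distrib]
        field_simp
    _ ≤ gtMomentConst D t c B Cₑ T₁ m q := by
        unfold gtMomentConst
        rw [hs1, ha₁]
        refine mul_le_mul_of_nonneg_left ?_ (by positivity)
        linarith [hs2, hs3]

/-! ### Pairs of indices -/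

/-- Sums over ordered pairs `j < j'` of an `s`-subfamily reindexed along a strictly monotone map are
dominated by the sum over all ordered pairs. [folklore] -/
theorem sum_pairs_comp_le {m s : ℕ} (σ : Fin s ↪o Fin m) (g : Fin m → Fin m → ℝ)
    (hg : ∀ i i', 0 ≤ g i i') :
    ∑ j : Fin s, ∑ j' : Fin s, (if j < j' then g (σ j) (σ j') else 0) ≤
      ∑ i : Fin m, ∑ i' : Fin m, if i < i' then g i i' else 0 := by
  classical
  -- both sides as sums over the product
  rw [← Finset.sum_product' (f := fun j j' => if j < j' then g (σ j) (σ j') else 0),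
    ← Finset.sum_product' (f := fun i i' => if i < i' then g i i' else 0)]
  have hinj : Set.InjOn (fun p : Fin s × Fin s => (σ p.1, σ p.2))
      ((Finset.univ : Finset (Fin s)) ×ˢ (Finset.univ : Finset (Fin s)) : Finset (Fin s × Fin s)) := by
    intro p _ p' _ h
    simp only [Prod.mk.injEq] at h
    exact Prod.ext (σ.injective h.1) (σ.injective h.2)
  have key := sum_comp_le_sum_of_injOn (s := (Finset.univ : Finset (Fin s)) ×ˢ Finset.univ)
    (T := (Finset.univ : Finset (Fin m)) ×ˢ Finset.univ)
    (f := fun p : Fin s × Fin s => (σ p.1, σ p.2)) hinj (fun p _ => Finset.mem_product.mpr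
      ⟨Finset.mem_univ _, Finset.mem_univ _⟩)
    (g := fun p : Fin m × Fin m => if p.1 < p.2 then g p.1 p.2 else 0)
    (fun p _ => by split_ifs <;> [exact hg _ _; exact le_rfl])
  refine le_trans (le_of_eq (Finset.sum_congr rfl fun p _ => ?_)) key
  simp only [σ.lt_iff_lt]

/-! ### The correlation estimate for `ν` -/

/-- **The correlation estimate for Green–Tao's measure** (Def. 6.3 for `ν`): at a scale where the
correlation display holds for every `2 ≤ s ≤ D` forms (constants `C_s ≤ Cₑ`) and the one-form
mean estimate holds with error `≤ c`, for `h₁, …, h_m ∈ ℤ_{N'}`, `2 ≤ m ≤ D`,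
`𝔼_n ∏ᵢ ν(n + hᵢ) ≤ ∑_{i<j} τ(hᵢ - hⱼ)`: the coincident case by the crude bound
(`sum_gtMeasure_pow_div_le`), otherwise by passing to `ν̃` (`prod_gtMeasure_le_sum_powerset`) and
treating each subset of weight factors (`sum_prod_gtWeightPart_le`, `sum_gtPreMeasure_le`).
[cite: GreenTao2010, App. D (proof of Prop. 6.4, verification of the correlation condition)] -/
theorem gtMeasure_correlation {D m : ℕ} (hm2 : 1 < m) (hmD : m ≤ D) (ht : 1 ≤ t)
    (hc : 0 < GreenTao2008.cChi χ) {B : ℝ} (hB : ∀ x, |χ x| ≤ B)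
    (hγ : 0 < γ) (hγ1 : γ ≤ 1) (hγD : 2 * D * γ ≤ 1) (hN : 1 ≤ N) {N' : ℕ} [NeZero N'] (hNN' : N < N')
    (hb : ∀ i, 1 ≤ b i ∧ b i ≤ primorial w ∧ Nat.Coprime (b i) (primorial w))
    {Cf : ℕ → ℝ} {Cₑ : ℝ} (hCₑ : 0 ≤ Cₑ)
    (hCf : ∀ s, 2 ≤ s → s ≤ D → 0 ≤ Cf s ∧ Cf s ≤ Cₑ ∧ CorrEstimateAt χ γ N w s (Cf s))
    {ε : ℝ} (hε : ε ≤ GreenTao2008.cChi χ) (hM : MeanEstimateAt χ γ N w ε)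
    {T₁ : ℝ} (hT₁ : (2 : ℝ) ^ D * max 1 ((1 / GreenTao2008.cChi χ) ^ D) * Cₑ ≤ T₁)
    (h : Fin m → ZMod N') :
    (∑ n : ZMod N', ∏ i, gtMeasure χ γ N w b N' (n + h i)) / N' ≤
      ∑ i : Fin m, ∑ j : Fin m,
        if i < j then gtTau D (GreenTao2008.cChi χ) B Cₑ T₁ m N w b N' (h i - h j) else 0 := by
  classical
  set c : ℝ := GreenTao2008.cChi χ with hcdef
  have hc0 : 0 < c := hc
  have hc' : c ≠ 0 := hc.ne'
  set T₀ : ℝ := coincidentBound c B m N with hT₀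
  set cD : ℝ := max 1 ((1 / c) ^ D) with hcD
  have hB0 : 0 ≤ B := (abs_nonneg _).trans (hB 0)
  have hT₀0 : 0 ≤ T₀ := coincidentBound_nonneg hc hB0 m hN
  have hcD1 : 1 ≤ cD := le_max_left _ _
  have hT₁0 : 0 ≤ T₁ := le_trans (by positivity) hT₁
  have hN'pos : (0 : ℝ) < N' := by exact_mod_cast (show 0 < N' by omega)
  have hNN'r : (N : ℝ) ≤ N' := by exact_mod_cast hNN'.le
  have hm1 : 1 ≤ m := by omega
  set PW : ℝ := ∑ i : Fin m, ∑ j : Fin m, if i < j then corrPairWeight Cₑ w b N' (h i - h j) else 0 with hPW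
  have hPW0 : 0 ≤ PW := Finset.sum_nonneg fun i _ => Finset.sum_nonneg fun j _ => by
    split_ifs <;> [exact corrPairWeight_nonneg _ _ _ _ _; exact le_rfl]
  set RHS : ℝ := ∑ i : Fin m, ∑ j : Fin m,
    if i < j then gtTau D c B Cₑ T₁ m N w b N' (h i - h j) else 0 with hRHS
  -- the right-hand side, expanded
  have hRHSeq : RHS = ∑ i : Fin m, ∑ j : Fin m, (if i < j then (2 : ℝ) ^ D else 0) +
      ∑ i : Fin m, ∑ j : Fin m, (if i < j then (if h i - h j = 0 then T₀ else 0) else 0) + T₁ * PW := by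
    rw [hRHS, hPW, Finset.mul_sum, ← Finset.sum_add_distrib, ← Finset.sum_add_distrib]
    refine Finset.sum_congr rfl fun i _ => ?_
    rw [Finset.mul_sum, ← Finset.sum_add_distrib, ← Finset.sum_add_distrib]
    refine Finset.sum_congr rfl fun j _ => ?_
    unfold gtTau
    split_ifs <;> ring
  have hpairs_nonneg1 : ∀ i j : Fin m, 0 ≤ (if i < j then (2 : ℝ) ^ D else 0) := fun i j => by
    split_ifs <;> [positivity; exact le_rfl]
  have hpairs_nonneg2 : ∀ i j : Fin m, 0 ≤ (if i < j then (if h i - h j = 0 then T₀ else 0) else 0) :=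
    fun i j => by split_ifs <;> first | exact hT₀0 | exact le_rfl
  -- lower bound 1: `RHS ≥ 2^D + T₁ PW`
  have i0 : Fin m := ⟨0, by omega⟩
  have i1 : Fin m := ⟨1, by omega⟩
  have hlb1 : (2 : ℝ) ^ D + T₁ * PW ≤ RHS := by
    rw [hRHSeq]
    have h1 : (2 : ℝ) ^ D ≤ ∑ i : Fin m, ∑ j : Fin m, (if i < j then (2 : ℝ) ^ D else 0) := by
      have hle1 : (if (⟨0, by omega⟩ : Fin m) < (⟨1, by omega⟩ : Fin m) then (2 : ℝ) ^ D else 0) ≤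
          ∑ j : Fin m, (if (⟨0, by omega⟩ : Fin m) < j then (2 : ℝ) ^ D else 0) :=
        Finset.single_le_sum (f := fun j => if (⟨0, by omega⟩ : Fin m) < j then (2 : ℝ) ^ D else 0)
          (fun j _ => hpairs_nonneg1 _ j) (Finset.mem_univ _)
      have hle2 : ∑ j : Fin m, (if (⟨0, by omega⟩ : Fin m) < j then (2 : ℝ) ^ D else 0) ≤
          ∑ i : Fin m, ∑ j : Fin m, (if i < j then (2 : ℝ) ^ D else 0) :=
        Finset.single_le_sum (f := fun i => ∑ j : Fin m, (if i < j then (2 : ℝ) ^ D else 0))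
          (fun i _ => Finset.sum_nonneg fun j _ => hpairs_nonneg1 i j) (Finset.mem_univ _)
      rw [if_pos (Fin.mk_lt_mk.mpr Nat.zero_lt_one)] at hle1
      exact hle1.trans hle2
    have h2 : 0 ≤ ∑ i : Fin m, ∑ j : Fin m, (if i < j then (if h i - h j = 0 then T₀ else 0) else 0) :=
      Finset.sum_nonneg fun i _ => Finset.sum_nonneg fun j _ => hpairs_nonneg2 i j
    linarith
  by_cases hinj : Function.Injective h
  · -- non-coincident shifts: pass to `ν̃` and treat each subset of weight factors
    have hstep1 : ∑ n : ZMod N', ∏ i, gtMeasure χ γ N w b N' (n + h i) ≤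
        ∑ S ∈ (Finset.univ : Finset (Fin m)).powerset,
          ∑ n : ZMod N', ∏ i ∈ S, gtWeightPart χ γ N w b N' (n + h i) := by
      rw [← Finset.sum_comm]
      exact Finset.sum_le_sum fun n _ => prod_gtMeasure_le_sum_powerset hγ.le hN h n
    -- each subset contributes at most `N' (1 + cD Cₑ PW)`
    have hS : ∀ S ∈ (Finset.univ : Finset (Fin m)).powerset,
        ∑ n : ZMod N', ∏ i ∈ S, gtWeightPart χ γ N w b N' (n + h i) ≤ N' * (1 + cD * Cₑ * PW) := by
      intro S _
      have hextra : (N' : ℝ) ≤ N' * (1 + cD * Cₑ * PW) := by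
        have : 0 ≤ cD * Cₑ * PW := by positivity
        nlinarith
      rcases Nat.lt_or_ge S.card 2 with hsmall | hbig
      · -- at most one weight factor
        interval_cases hS : S.card
        · rw [Finset.card_eq_zero.mp hS]
          simp only [Finset.prod_empty, Finset.sum_const, Finset.card_univ, ZMod.card, nsmul_eq_mul,
            mul_one]
          exact hextra
        · obtain ⟨i, rfl⟩ := Finset.card_eq_one.mp hS
          simp only [Finset.prod_singleton]
          rw [sum_gtWeightPart_shift_eq hNN']
          have := sum_gtPreMeasure_le ht hc hb hε hM
          nlinarith
      · -- `s ≥ 2` weight factors: the correlation display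
        set s := S.card with hs
        have hsD : s ≤ D := (Finset.card_le_univ S).trans (by rw [Fintype.card_fin]; exact hmD)
        obtain ⟨hCs0, hCsle, hCorr⟩ := hCf s hbig hsD
        set σ := S.orderEmbOfFin rfl with hσ
        have he : Function.Injective (fun j => h (σ j)) := hinj.comp σ.injective
        rw [Finset.sum_congr rfl fun n _ => prod_eq_prod_orderEmbOfFin S rfl (fun i => gtWeightPart χ γ N w b N' (n + h i))]
        have key := sum_prod_gtWeightPart_le (χ := χ) (by omega) hγ.le hN ht hc hb hNN' hCs0 hCorr hCsle
          (fun j => h (σ j)) he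
        have hpairs := sum_pairs_comp_le σ (fun i i' => corrPairWeight Cₑ w b N' (h i - h i'))
          (fun _ _ => corrPairWeight_nonneg _ _ _ _ _)
        have hcs : (1 / c) ^ s ≤ cD := by
          rw [hcD]
          rcases le_or_gt (1 / c) 1 with h1 | h1
          · exact (pow_le_one₀ (by positivity) h1).trans (le_max_left _ _)
          · exact (pow_le_pow_right₀ h1.le hsD).trans (le_max_right _ _)
        calc ∑ n : ZMod N', ∏ j : Fin s, gtWeightPart χ γ N w b N' (n + h (σ j))
            ≤ (1 / c) ^ s * Cf s * N * ∑ j : Fin s, ∑ j' : Fin s,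
                if j < j' then corrPairWeight Cₑ w b N' (h (σ j) - h (σ j')) else 0 := key
          _ ≤ cD * Cₑ * N' * PW := by
              refine mul_le_mul (mul_le_mul (mul_le_mul hcs hCsle hCs0 (by positivity)) hNN'r
                (Nat.cast_nonneg N) (by positivity)) hpairs (Finset.sum_nonneg fun j _ =>
                Finset.sum_nonneg fun j' _ => by
                  split_ifs <;> [exact corrPairWeight_nonneg _ _ _ _ _; exact le_rfl]) (by positivity)
          _ ≤ N' * (1 + cD * Cₑ * PW) := by nlinarith
    have hstep2 : ∑ S ∈ (Finset.univ : Finset (Fin m)).powerset,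
        ∑ n : ZMod N', ∏ i ∈ S, gtWeightPart χ γ N w b N' (n + h i) ≤ (2 : ℝ) ^ m * (N' * (1 + cD * Cₑ * PW)) := by
      refine (Finset.sum_le_sum hS).trans (le_of_eq ?_)
      rw [Finset.sum_const, Finset.card_powerset, Finset.card_univ, Fintype.card_fin, nsmul_eq_mul]
      push_cast
      ring
    have h2m : (2 : ℝ) ^ m ≤ (2 : ℝ) ^ D := pow_le_pow_right₀ (by norm_num) hmD
    rw [div_le_iff₀ hN'pos]
    calc ∑ n : ZMod N', ∏ i, gtMeasure χ γ N w b N' (n + h i)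
        ≤ (2 : ℝ) ^ m * (N' * (1 + cD * Cₑ * PW)) := hstep1.trans hstep2
      _ ≤ (2 : ℝ) ^ D * (N' * (1 + cD * Cₑ * PW)) :=
          mul_le_mul_of_nonneg_right h2m (by positivity)
      _ = ((2 : ℝ) ^ D + ((2 : ℝ) ^ D * cD * Cₑ) * PW) * N' := by ring
      _ ≤ ((2 : ℝ) ^ D + T₁ * PW) * N' := by
          refine mul_le_mul_of_nonneg_right (add_le_add le_rfl (mul_le_mul_of_nonneg_right hT₁ hPW0))
            hN'pos.le
      _ ≤ RHS * N' := mul_le_mul_of_nonneg_right hlb1 hN'pos.le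
  · -- coincident shifts: `𝔼 ∏ ν(n + hᵢ) ≤ 𝔼 ν^m ≤ T₀ ≤ τ(0)`
    obtain ⟨i, j, hij, hne⟩ : ∃ i j, h i = h j ∧ i ≠ j := by
      rw [Function.Injective] at hinj
      push Not at hinj
      obtain ⟨i, j, hij, hne⟩ := hinj
      exact ⟨i, j, hij, hne⟩
    -- order the pair
    obtain ⟨i₀, j₀, hlt, heq⟩ : ∃ i₀ j₀ : Fin m, i₀ < j₀ ∧ h i₀ = h j₀ := by
      rcases lt_or_gt_of_ne hne with hl | hl
      · exact ⟨i, j, hl, hij⟩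
      · exact ⟨j, i, hl, hij.symm⟩
    have hlb2 : T₀ ≤ RHS := by
      rw [hRHSeq]
      have h1 : 0 ≤ ∑ i : Fin m, ∑ j : Fin m, (if i < j then (2 : ℝ) ^ D else 0) :=
        Finset.sum_nonneg fun i _ => Finset.sum_nonneg fun j _ => hpairs_nonneg1 i j
      have h2 : T₀ ≤ ∑ i : Fin m, ∑ j : Fin m, (if i < j then (if h i - h j = 0 then T₀ else 0) else 0) := by
        have hle1 : (if i₀ < j₀ then (if h i₀ - h j₀ = 0 then T₀ else 0) else 0) ≤
            ∑ j : Fin m, (if i₀ < j then (if h i₀ - h j = 0 then T₀ else 0) else 0) :=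
          Finset.single_le_sum (f := fun j => if i₀ < j then (if h i₀ - h j = 0 then T₀ else 0) else 0)
            (fun j _ => hpairs_nonneg2 i₀ j) (Finset.mem_univ _)
        have hle2 : ∑ j : Fin m, (if i₀ < j then (if h i₀ - h j = 0 then T₀ else 0) else 0) ≤
            ∑ i : Fin m, ∑ j : Fin m, (if i < j then (if h i - h j = 0 then T₀ else 0) else 0) :=
          Finset.single_le_sum (f := fun i => ∑ j : Fin m, (if i < j then (if h i - h j = 0 then T₀ else 0) else 0))
            (fun i _ => Finset.sum_nonneg fun j _ => hpairs_nonneg2 i j) (Finset.mem_univ _)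
        rw [if_pos hlt, if_pos (by rw [heq, sub_self])] at hle1
        exact hle1.trans hle2
      have h3 : 0 ≤ T₁ * PW := by positivity
      linarith
    have hmγ : 2 * m * γ ≤ 1 := by
      have : (2 : ℝ) * m * γ ≤ 2 * D * γ := by
        have : (m : ℝ) ≤ D := by exact_mod_cast hmD
        nlinarith
      linarith
    calc (∑ n : ZMod N', ∏ i, gtMeasure χ γ N w b N' (n + h i)) / N'
        ≤ (∑ n : ZMod N', gtMeasure χ γ N w b N' n ^ m) / N' :=
          div_le_div_of_nonneg_right (sum_prod_shift_le_sum_pow hm1 _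
            (fun x => gtMeasure_nonneg χ hγ.le hN w b N' x) h) hN'pos.le
      _ ≤ T₀ := sum_gtMeasure_pow_div_le ht hc hγ.le hγ1 hm1 hmγ hN hB hb hNN'
      _ ≤ RHS := hlb2

/-! ### The correlation condition from the two displays -/

/-- A smooth compactly supported cutoff is bounded. [folklore] -/
theorem exists_bound_of_cutoff {χ : ℝ → ℝ} (hχ : IsSmoothCompactCutoff χ) : ∃ B : ℝ, ∀ x, |χ x| ≤ B := by
  have hcont : Continuous χ := hχ.contDiff.continuous
  have hsupp : HasCompactSupport χ :=
    HasCompactSupport.intro isCompact_Icc fun x hx => hχ.eq_zero hx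
  obtain ⟨C, hC⟩ := hcont.bounded_above_of_compact_support hsupp
  exact ⟨C, fun x => by simpa [Real.norm_eq_abs] using hC x⟩

/-- **The correlation condition for Green–Tao's measure from the two Goldston–Yıldırım displays**
(Green–Tao 2010, App. D, proof of Prop. 6.4: "Now we verify the `D`-correlation condition for
`ν`. As before we can pass from `ν` to `ν̃` … We may assume that no two of the `h_i` are equal as
in this case one can use crude divisor estimates, setting `τ(0)` to be moderately large … we split
up `ν̃` and reduce to showing [the correlation display] … It follows from this analysis that if we
set `τ(n) := ∑_{j<j'} exp(O(∑_{p>w, p | Wn + b_{i_j} - b_{i_{j'}}} p^{-1/2}))` then we obtain the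
desired correlation estimate. To show the moment bounds on `τ` …"). The one-form case of the linear
forms display (D.8) supplies `𝔼 ν̃ = O(1)` for the subsets with a single weight factor.
Discharges `GreenTao2010_envelopingSieve_correlationCondition` relative to the two displays of
`LinearEquationsInPrimesEnvelopingSieveFacts.lean`.
[cite: GreenTao2010, App. D (proof of Prop. 6.4, verification of the correlation condition)] -/
theorem GreenTao2010_envelopingSieve_correlationCondition_of_linearForms_of_correlations
    (hLF : GreenTao2010_envelopingSieve_linearForms) (hCF : GreenTao2010_envelopingSieve_correlations) :
    GreenTao2010_envelopingSieve_correlationCondition := by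
  intro D t hD ht C hC χ hχ hc
  obtain ⟨B, hB⟩ := exists_bound_of_cutoff hχ
  have hB0 : 0 ≤ B := (abs_nonneg _).trans (hB 0)
  set c : ℝ := GreenTao2008.cChi χ with hcdef
  have hc0 : 0 < c := hc
  have hc' : c ≠ 0 := hc.ne'
  -- thresholds of the one-form mean estimate
  obtain ⟨γ₁, hγ₁, H1⟩ := meanEstimateAt_of_linearForms hLF hχ
  -- exponents of the correlation display for each number of forms, made total in `s`
  have H2 : ∀ s : ℕ, ∃ γ₀ : ℝ, 0 < γ₀ ∧ (2 ≤ s → ∀ γ : ℝ, 0 < γ → γ ≤ γ₀ → ∃ Cs : ℝ, 0 < Cs ∧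
      ∃ w₀ N₀ : ℕ, ∀ N : ℕ, N₀ ≤ N → ∀ w : ℕ, w₀ ≤ w → (w : ℝ) ≤ Real.log (Real.log N) / 2 →
        CorrEstimateAt χ γ N w s Cs) := by
    intro s
    by_cases hs : 2 ≤ s
    · obtain ⟨γ₀, hγ₀, H⟩ := corrEstimateAt_of_correlations hCF hs hχ
      exact ⟨γ₀, hγ₀, fun _ => H⟩
    · exact ⟨1, one_pos, fun h => absurd h hs⟩
  choose γF hγF HF using H2
  have hne : (Finset.Icc 2 D).Nonempty := ⟨2, Finset.mem_Icc.mpr ⟨le_rfl, hD⟩⟩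
  set γm : ℝ := (Finset.Icc 2 D).inf' hne γF with hγm
  have hγm0 : 0 < γm := by
    rw [hγm]; exact (Finset.lt_inf'_iff hne).mpr fun s _ => hγF s
  have hD1 : (1 : ℝ) ≤ D := by exact_mod_cast (show 1 ≤ D by omega)
  have hD0 : (0 : ℝ) < D := by linarith
  refine ⟨min (min γ₁ γm) (1 / (2 * D)), lt_min (lt_min hγ₁ hγm0) (by positivity), fun γ hγ hγle => ?_⟩
  have hγγ₁ : γ ≤ γ₁ := hγle.trans ((min_le_left _ _).trans (min_le_left _ _))
  have hγs : ∀ s, 2 ≤ s → s ≤ D → γ ≤ γF s := fun s hs1 hs2 =>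
    hγle.trans ((min_le_left _ _).trans ((min_le_right _ _).trans
      (Finset.inf'_le _ (Finset.mem_Icc.mpr ⟨hs1, hs2⟩))))
  have hγD : γ ≤ 1 / (2 * D) := hγle.trans (min_le_right _ _)
  have hγD' : 2 * D * γ ≤ 1 := by
    have := (le_div_iff₀ (by positivity : (0 : ℝ) < 2 * D)).mp hγD
    linarith
  have hγ1 : γ ≤ 1 := by nlinarith
  -- constants and thresholds of the correlation display at this `γ`
  have H3 : ∀ s : ℕ, ∃ Cs : ℝ, 0 < Cs ∧ ∃ w₀ N₀ : ℕ, (2 ≤ s → s ≤ D →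
      ∀ N : ℕ, N₀ ≤ N → ∀ w : ℕ, w₀ ≤ w → (w : ℝ) ≤ Real.log (Real.log N) / 2 →
        CorrEstimateAt χ γ N w s Cs) := by
    intro s
    by_cases hs : 2 ≤ s ∧ s ≤ D
    · obtain ⟨Cs, hCs, w₀, N₀, H⟩ := HF s hs.1 γ hγ (hγs s hs.1 hs.2)
      exact ⟨Cs, hCs, w₀, N₀, fun _ _ => H⟩
    · exact ⟨1, one_pos, 0, 0, fun h1 h2 => absurd ⟨h1, h2⟩ hs⟩
  choose Cf hCf0 w₀f N₀f HCf using H3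
  set Cₑ : ℝ := (Finset.Icc 2 D).sup' hne Cf with hCₑ
  have hCₑ0 : 0 < Cₑ := by
    rw [hCₑ]; exact (Finset.lt_sup'_iff hne).mpr ⟨2, Finset.mem_Icc.mpr ⟨le_rfl, hD⟩, hCf0 2⟩
  have hCfle : ∀ s, 2 ≤ s → s ≤ D → Cf s ≤ Cₑ := fun s hs1 hs2 => by
    rw [hCₑ]; exact Finset.le_sup' Cf (Finset.mem_Icc.mpr ⟨hs1, hs2⟩)
  obtain ⟨w₁, N₁, HM⟩ := H1 γ hγ hγγ₁ c hc
  set T₁ : ℝ := (2 : ℝ) ^ D * max 1 ((1 / c) ^ D) * Cₑ with hT₁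
  have hT₁0 : 0 ≤ T₁ := by positivity
  refine ⟨fun m q => gtMomentConst D t c B Cₑ T₁ m q, max w₁ ((Finset.Icc 2 D).sup w₀f),
    max (max N₁ ((Finset.Icc 2 D).sup N₀f)) 2, ?_⟩
  intro N hN w hw hwN N' _ hN'p hCN hN'C b hb
  -- thresholds at this scale
  have hN2 : 2 ≤ N := le_trans (le_max_right _ _) hN
  have hN1 : 1 ≤ N := by omega
  have hNN₁ : N₁ ≤ N := le_trans ((le_max_left _ _).trans (le_max_left _ _)) hN
  have hww₁ : w₁ ≤ w := le_trans (le_max_left _ _) hw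
  have hNs : ∀ s, 2 ≤ s → s ≤ D → N₀f s ≤ N := fun s hs1 hs2 =>
    le_trans ((Finset.le_sup (f := N₀f) (Finset.mem_Icc.mpr ⟨hs1, hs2⟩)).trans
      ((le_max_right _ _).trans (le_max_left _ _))) hN
  have hws : ∀ s, 2 ≤ s → s ≤ D → w₀f s ≤ w := fun s hs1 hs2 =>
    le_trans ((Finset.le_sup (f := w₀f) (Finset.mem_Icc.mpr ⟨hs1, hs2⟩)).trans (le_max_right _ _)) hw
  have hNN' : N < N' := by
    have h1 : (N : ℝ) < C * N := by
      have : (0 : ℝ) < N := by exact_mod_cast (show 0 < N by omega)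
      nlinarith
    exact_mod_cast h1.trans_le hCN
  have hMean : MeanEstimateAt χ γ N w c := HM N hNN₁ hN1 w hww₁ hwN
  have hCorr : ∀ s, 2 ≤ s → s ≤ D → 0 ≤ Cf s ∧ Cf s ≤ Cₑ ∧ CorrEstimateAt χ γ N w s (Cf s) :=
    fun s hs1 hs2 => ⟨(hCf0 s).le, hCfle s hs1 hs2,
      HCf s hs1 hs2 N (hNs s hs1 hs2) w (hws s hs1 hs2) hwN⟩
  -- the correlation condition
  intro m hm1 hmD
  refine ⟨gtTau D c B Cₑ T₁ m N w b N', fun x => gtTau_nonneg hc hB0 hT₁0 m hN1 w b N' x,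
    fun q hq => ?_, fun h => ?_⟩
  · exact sum_gtTau_rpow_div_le hc hB0 hCₑ0.le hT₁0 ht m hq hN2 hwN hNN'
      (fun i => ⟨(hb i).1, (hb i).2.1⟩)
  · exact gtMeasure_correlation hm1 hmD ht hc hB hγ hγ1 hγD' hN1 hNN' hb hCₑ0.le hCorr le_rfl hMean
      le_rfl h

end Literature.NumberTheory.Sieve

end
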